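import Literature.Claims.NS.ClayVariants
import Literature.Analysis.FluidPDE.SuitableWeak
import Literature.Analysis.FluidPDE.BoundedLerayHopfClay
import Literature.Analysis.FluidPDE.LeraySuitableWeakSolutions
import Mathlib.MeasureTheory.Integral.IntervalIntegral.Basic
import Mathlib.Analysis.SpecialFunctions.Pow.Deriv
import HarnessLib

/-!
# Claim skeleton: S. Taghizadeh (2026), «Vanishing of the Local Monotonicity Limit and Global Regularity
# for the 3D Incompressible Navier–Stokes Equations»

Cell `ns-claims` (D-0090 NS-CLAIMS SWEEP), claim **C166** (RULINGS v1.42, 2026-08-27T14:27:37Z), typist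
`ns-claims-typist-10` g5 (refuter-1 g5, second refuter-7 g4, REF ref-2 g7, 2-READ typist-11 g7, salvage-p2 g6,
sources lit-1). UNREFEREED CLAIM under adjudication — NOTHING in this file asserts a step: every `Step…` is a
`Prop` (a printed assertion typed as an implication «standing objects ∧ the displays its printed proof invokes →
the display»); the only `theorem`s are the kernel COMPOSITIONS of the paper's own implications and plumbing.

Version of record: Zenodo record 18468522 (concept 18434204, v2 `is_last`, 2026-02-03), PDF sha16
a24b05d3aebfa0c6, 13 pp., PDF page = printed page [Taghizadeh2026]. COMPANION OF RECORD (cited source, not a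
second row, v1.42): Zenodo 18468477, «A Local Monotonicity Reduction of the 3D Navier–Stokes Regularity Problem»,
24 pp. [TaghizadehReduction2026]. Two statements are IMPORTED from the companion WITHOUT proof and typed AT THE
GRAIN THE PRESENT TEXT PRINTS THEM (v1.42 typing rule), with the companion page as second locator: §2.9
almost-monotonicity (= companion (63)/(64) p.16) and §5.3 reduction principle (= companion Prop 9.1 p.20).

## Claimed statement (as printed)

Theorem 1.1 p.2 l.31–41 (= Theorem 5.1 p.12 l.31–37): «Let (u, p) be a suitable weak solution of the
three-dimensional incompressible Navier–Stokes equations on R³ × (0, T). Then for every spacetime point z0,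
lim_{r↓0} I(r; z0) = 0.» + «Combined with the reduction principle established in the companion paper, this result
implies global regularity for all smooth divergence-free initial data.» §5.4 p.13 l.1–15: «Since every spacetime
point is regular, suitable weak solutions are smooth on R³ × (0, T]. In particular, if the initial data satisfy
u0 ∈ C₀^∞(R³), ∇ · u0 = 0, then the corresponding solution … satisfies u ∈ C^∞(R³ × (0, ∞)).»
Typed: `ClaimedTheorem ν lam χ` = Thm 1.1 over the suitable-weak-solution class of §2.1 p.4 (tree
`IsSuitableWeakSolutionOn` on the open slab + the GLOBAL `L^∞_t L²_x` / `L²_t Ḣ¹_x` items of §2.1) and the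
functional `I` of §2.4–§2.8 typed CONCRETELY modulo its printed parameters (viscosity `ν`, the «universal» constant
`λ > 0` of §2.6 p.5 l.86 — never specified — and the cutoff `χ` of §2.4 p.4, any `C^∞` function with `χ ≡ 1` on
`[0,1]`, `χ ≡ 0` on `[2,∞)`); `ClaimedCorollary ν lam χ` = the §5.3–§5.4 passage (every point regular).

## Clay delta (reference `ClayVariants.lean`)

Nearest (A) `ClayVariants.clayR3.Regularity`. Δ1 domain ℝ³ «=» · Δ3 force none «=» · Δ4 DATA: Thm 1.1 is about
EVERY suitable weak solution (data `u0 ∈ L²`, div-free — wider than (4)); the §5.4 corollary is printed for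
`u0 ∈ C₀^∞` (narrower than (4)'s Schwartz-type class) while §5.5/abstract say «all smooth divergence-free data» ·
Δ5 SOLUTION CLASS: suitable weak solutions (CKN [2]); (A) asks a smooth solution FROM THE DATUM — bridge (existence
of a global suitable weak solution from a (4)-datum agreeing with the local smooth solution; weak–strong
uniqueness) not printed · Δ6 CONCLUSION: «smooth on ℝ³ × (0, T]», «C^∞(ℝ³ × (0,∞))» — OPEN AT t = 0 as printed
((6) asks [0,∞)); no energy clause (7) · Δ7: `ν > 0` fixed; «universal» `λ` and the cutoff `χ` unspecified —
every statement below is typed ∀ (equivalently, parametrised by) `λ > 0` and admissible `χ`. STRENGTH: Thm 1.1 is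
a universal a-priori law for every suitable weak solution at every point. CLAY LINK: `clayA_of_claimed` PROVED —
`clayR3.RegularityAt ν` from `ClaimedTheorem` + `Step53_Reduction` through the tree door
`clay_solution_of_locallyBounded_globalLerayHopf` (which supplies the t = 0 layer and (7)), MODULO the one named
bridge `ClayBridge_SuitableLerayHopf ν` (Δ5: the global Leray–Hopf solution from a Clay datum lies in the §2.1
class on every slab — CKN 1982 Appendix, not in the tree in this vocabulary); `clayA_regularity_of_steps` = (A).

## Steps (dependency order; `I`, `D` = the functionals of §2.6 / §4.1, `z0 = (t0, x0)` TIME FIRST as in the tree)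

* `Step27_Normalisation` — §2.7 p.6 l.1–4: constants have `I ≡ 0`. TRUE-type (plumbing integral).
* `Step29_AlmostMono` — §2.9 p.6 l.36–56 (IMPORTED: companion (63)/(64) p.16 l.46–65 ← Lemma 7.1 (62)), in the
  INTEGRATED form in which §3.1/§4.1 consume it (with Lemma 2.1 p.7): scale-difference inequality with the
  dissipation square term `D`, and existence of the limit `I0(z0)`. Constants `c, C, α, r*` typed AFTER the
  solution and the point (weakest reading of «There exist constants», F11).
* `Step32_Rescale` — §3.2 p.7 l.39–53: the NS rescaling about `z0` at scale `r` is a suitable weak solution on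
  `(−t0/r², 0) × ℝ³`. TRUE-type (change of variables).
* `Step33_ScaleInvariance` — §3.3 p.8 l.1–5 (§2.3 p.4 l.76–78; reused §3.7, §4.1): `I^{(r)}(R;0) = I(rR; z0)` and
  `D^{(r)}(R;0) = D(rR; z0)` AS PRINTED; see the bookkeeping note in its docstring (the typed `Φ` is the print's,
  `Φ_{r,z0} ∼ r^{−3}`).
* `Step34_Bounds` — §3.4 p.8 l.10–26 AT THE SOLUTION GRAIN (the rescaled sequence of a solution of the class,
  `I^{(k)}(1;0) ≤ C` ⇒ the two displayed bounds); `Step34F_Bounds` = the same inference at the grain of its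
  printed justification («from the definition of I and the nonnegativity of its coercive components») — the
  refuter's functions-face handle, NOT consumed by the composition.
* `Step35_Compactness` — §3.5 p.8 l.27–57: bounds ⇒ a subsequence converging (strong `L²`, weak `H¹`, weak
  `L^{3/2}` on compacts of the closed past) to an ANCIENT suitable weak solution. Classical-type modulo the class.
* `StepL31_Stability` — Lemma 3.1 p.8 l.58–102 VERBATIM: for ANY sequence of ancient suitable weak solutions
  with those convergences, `I^{(k)}(R;0) → I*(R;0)` for every `R > 0` (the printed proof calls `E1` «lower
  semicontinuous» and concludes the equality).
* `Step37_PersistentValue` — §3.6–§3.7 p.9 l.1–31: from a point with `I0(z0) = ε0 > 0`, blow-up scales and an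
  ancient limit of the rescaled sequence with `I*(R;0) = ε0` for all `R > 0` (printed inputs: 32, 33, 34, 35, L31,
  29 + Lemma 2.1; the refinement/continuity bookkeeping is the paper's).
* `Step41_ExactInequality` — §4.1 p.9 l.43 – p.10 l.26: in that situation the limit obeys the exact scale-difference
  inequality (printed inputs: 29 at scales `r_kρ`, 33 for `I` and `D`, L31, «lower semicontinuity of D»).
* `Step3_Package` — §3.8 p.9 l.32–35 summary = 37 ∧ 41 (DERIVED: `package_of_steps`).
* `Step42_Vanishing` — §4.2 p.10 l.27–53: constancy + exact inequality ⇒ `D*(ρ;0) = 0` for a.e. `ρ > 0`. TRUE-type.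
* `StepL41_Rigidity` — Lemma 4.1 p.10 l.71 – p.11 l.36: `D*(R;0) = 0` ⇒ `u* = 0` a.e. on `Q_{R/2}(0)`. TRUE-type.
* `Step44_Contradiction` — §4.4 p.11 l.37–54 as printed: `u* = 0` on the interior cylinders ⇒ `I*(1;0) = 0`
  (via the normalisation; `p*` untouched — v1.42 hazard (c)). TRUE-type as typed (every term of `I` carries a
  factor `u` or `∇u`).
* `Step45_NonnegLimit_implicit` — UNPRINTED, NEEDED BY §4.5 p.11 l.55–60 («the assumption ∃ z0 : I0(z0) > 0 is
  false. Therefore, I0(z0) = 0 for all z0»): the limit `I0(z0)` is `≥ 0`. `I` has the SIGNED terms `−C − C_harm`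
  (§2.6) and no line of the text gives `I0 ≥ 0`; typed as its own binder per README LEAN CONVENTIONS 4 («a needed
  implication that is itself a substantive unprinted claim becomes its own Step, named implicit») — the chair
  may read it as the LOGIC locator «¬(I0 > 0) ↛ I0 = 0 (p.11 l.58–60)».
* `Step53_Reduction` — §5.3 p.12 l.40–48 (IMPORTED: companion Prop 9.1 p.20 l.3–13, via «the standard CKN
  control estimate» (76)): `I0(z0) = 0` at a point ⇒ the point is regular (tree `IsRegularPoint`).
* `Step54_Smooth` — §5.4 p.13 l.2–3: every point regular ⇒ smooth on the open slab.

COMPOSITION: `claim_of_steps` PROVED (Thm 1.1 from Steps 29, 37, 41, 42, L41, 44, 45 — the contradiction closes with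
`I*(1;0) = 0 ≠ ε0`; `package_of_steps` 37 ∧ 41 ⇒ §3.8); `corollary_of_steps` PROVED (§5.3–§5.4 from Thm 1.1, Step53,
Step54). Steps 27, 32, 33, 34, 35, L31 are the PRINTED INPUTS of 37/41 and are exposed separately for the refuter
(dependency recorded in the docstrings of 37/41: §3.5 consumes 34; §3.6 consumes L31; §3.7 consumes 33 + L31 + 29;
§4.1 consumes 29 + 33 + L31).

WHAT THIS IS NOT: not a claim about NS regularity or blow-up; not a claim about any author beyond the typed locator.
-/

noncomputable section

open Set Function Filter MeasureTheory Metric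
open scoped Topology ENNReal NNReal ContDiff InnerProductSpace RealInnerProductSpace

namespace Literature.Claims.NS.Taghizadeh2026

open Literature.Analysis.FluidPDE

/-- Physical space `ℝ³` (the print's `R³`, §2.1 p.4 l.1). [cite: Taghizadeh2026, §2.1 p.4 l.1–4] -/
abbrev E3 : Type := EuclideanSpace ℝ (Fin 3)

/-! ### §2.1 p.4 — the solution classes (tree vocabulary `IsSuitableWeakSolutionOn`; space-time points are
`z = (t, x) : ℝ × E3`, TIME FIRST, as in the tree's `parabolicCylinder r z = (t − r², t) × B_r(x)` = the print's
`Q_r(z0) = B_r(x0) × (t0 − r², t0)` §2.3 p.4) -/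

/-- The open slab `(0,T) × ℝ³` («R³ × (0, T)», §2.1 p.4). [cite: Taghizadeh2026, §2.1 p.4 l.1–4] -/
def slab (T : ℝ) : TopologicalSpace.Opens (ℝ × E3) :=
  ⟨Ioo 0 T ×ˢ univ, isOpen_Ioo.prod isOpen_univ⟩

/-- The open past half-space `(−∞,0) × ℝ³` — the region of the ANCIENT solutions of §3.5 p.8 l.52–57 («a suitable
weak solution on R³ × (−∞, 0], and hence an ancient solution»; the open version carries every cylinder `Q_R(0)`
= `(−R², 0) × B_R`). [cite: Taghizadeh2026, §3.5 p.8 l.52–57] -/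
def past : TopologicalSpace.Opens (ℝ × E3) :=
  ⟨Iio 0 ×ˢ univ, isOpen_Iio.prod isOpen_univ⟩

/-- The closed past `(−∞,0] × ℝ³`, over whose compact subsets the convergences of §3.5 / Lemma 3.1 are stated
(«on every compact K ⊂ R³ × (−∞, 0]», p.8 l.62). [cite: Taghizadeh2026, Lemma 3.1 p.8 l.58–71] -/
def pastClosed : Set (ℝ × E3) := Iic 0 ×ˢ univ

/-- **§2.1 p.4 — suitable weak solution on `R³ × (0,T)`**, items 1–4 («u ∈ L^∞(0,T;L²(R³)) ∩ L²(0,T;H¹(R³))»,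
«p ∈ L^{3/2}_loc», «the Navier–Stokes equations in the sense of distributions», «the local energy inequality»
[2] = CKN): the tree's `IsSuitableWeakSolutionOn` on the open slab (items 2–4 and the LOCAL halves of item 1,
with a weak spatial gradient `G` of `u` made explicit — `∇u` below IS `G`), plus the GLOBAL integrability of
item 1. Unforced, viscosity `ν`. (The datum `u0 ∈ L²` of §2.1 l.1 enters no display before §5.4 and is not a
field.) [cite: Taghizadeh2026, §2.1 p.4 l.1–12] -/
structure IsSolution (ν T : ℝ) (u : ℝ → E3 → E3) (p : ℝ → E3 → ℝ) (G : ℝ → E3 → E3 →L[ℝ] E3) : Prop where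
  /-- items 2–4 and local item 1 (CKN suitability on the open slab). -/
  suitable : IsSuitableWeakSolutionOn (slab T) ν 0 u p
  /-- `G = ∇u` weakly on the slab. -/
  grad : HasWeakSpatialGradientOn (slab T) u G
  /-- item 1, global: `u ∈ L^∞(0,T; L²(ℝ³))`. -/
  energy : ∃ C : ℝ≥0, ∀ᵐ t ∂(volume.restrict (Ioo 0 T)), ∫⁻ x, ‖u t x‖ₑ ^ 2 ≤ C
  /-- item 1, global: `∇u ∈ L²((0,T) × ℝ³)`. -/
  dissipation : ∫⁻ z in (slab T : Set (ℝ × E3)), ENNReal.ofReal (frobeniusNormSq (G z.1 z.2)) < ⊤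

/-- **An ANCIENT suitable weak solution** («a suitable weak solution on R³ × (−∞, 0]», §3.5 p.8 l.52–57; Lemma
3.1 p.8 l.58–61; Lemma 4.1 p.10 l.71–75): CKN suitability on the open past with an explicit weak spatial gradient.
(The GLOBAL `L²` items of §2.1 are NOT imposed — a blow-up limit has none; this is the reading §3.4 l.25–26 «on
every compact subset» and §3.5 use.) [cite: Taghizadeh2026, §3.5 p.8 l.52–57] -/
structure IsAncient (ν : ℝ) (u : ℝ → E3 → E3) (p : ℝ → E3 → ℝ) (G : ℝ → E3 → E3 →L[ℝ] E3) : Prop where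
  /-- CKN suitability on `(−∞,0) × ℝ³`. -/
  suitable : IsSuitableWeakSolutionOn past ν 0 u p
  /-- `G = ∇u` weakly on the past. -/
  grad : HasWeakSpatialGradientOn past u G

/-! ### §2.3–§2.8 p.4–6 — the functional `I(r; z0)` and the dissipation square term `D(r; z0)`, typed CONCRETELY
modulo the printed parameters: `ν` (in `G_{z0}`), the «universal» `λ > 0` (§2.6 p.5 l.86) and the cutoff `χ`
(§2.4 p.4 l.91–93). Bochner integrals over the cylinder with the product Lebesgue measure on `ℝ × E3` (junk `0`
if not integrable — the typed steps quantify over the class, where the refuter decides integrability). -/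

/-- An admissible cutoff: «Fix a cutoff χ ∈ C_c^∞([0, ∞)) such that χ ≡ 1 on [0, 1], χ ≡ 0 on [2,∞)» (§2.4 p.4
l.91–93), with the conventional `χ ≥ 0` ADDED (charitable, not printed: it is what makes `Φ ≥ 0`, which the bullets
of §2.4 p.5 l.11–15 and «D*(ρ; 0) ≥ 0» p.10 l.19–26 presuppose; a kill must not rest on a sign-changing cutoff).
[cite: Taghizadeh2026, §2.4 p.4 l.91–93] -/
structure IsCutoff (χ : ℝ → ℝ) : Prop where
  smooth : ContDiff ℝ ∞ χ
  eq_one : ∀ s ∈ Icc (0 : ℝ) 1, χ s = 1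
  eq_zero : ∀ s : ℝ, 2 ≤ s → χ s = 0
  nonneg : ∀ s : ℝ, 0 ≤ χ s

/-- The backward heat kernel `G_{z0}(x,t) = (4πν(t0 − t))^{−3/2} exp(−|x − x0|²/(4ν(t0 − t)))`, `t < t0` (§2.4
p.4 l.80–88); typed `0` for `t ≥ t0`. [cite: Taghizadeh2026, §2.4 p.4 l.80–88] -/
def heatKer (ν : ℝ) (z0 : ℝ × E3) (t : ℝ) (x : E3) : ℝ :=
  if t < z0.1 then
    (4 * Real.pi * ν * (z0.1 - t)) ^ (-(3 : ℝ) / 2) * Real.exp (-(‖x - z0.2‖ ^ 2) / (4 * ν * (z0.1 - t)))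
  else 0

/-- The normalised parabolic distance `s(x,t) = |x − x0|²/r² + (t0 − t)/r²` (§2.4 p.5 l.1–7).
[cite: Taghizadeh2026, §2.4 p.5 l.1–7] -/
def sdist (r : ℝ) (z0 : ℝ × E3) (t : ℝ) (x : E3) : ℝ :=
  ‖x - z0.2‖ ^ 2 / r ^ 2 + (z0.1 - t) / r ^ 2

/-- The localised kernel `Φ_{r,z0}(x,t) = G_{z0}(x,t) χ(s(x,t))` (§2.4 p.5 l.8–10). [cite: Taghizadeh2026, §2.4 p.5 l.8–10] -/
def Phi (ν : ℝ) (χ : ℝ → ℝ) (r : ℝ) (z0 : ℝ × E3) (t : ℝ) (x : E3) : ℝ :=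
  heatKer ν z0 t x * χ (sdist r z0 t x)

/-- The scale primitive `Ψ_{r,z0}(x,t) = ∫₀ʳ σ Φ_{σ,z0}(x,t) dσ` (§2.5 p.5 l.17–21). [cite: Taghizadeh2026, §2.5 p.5 l.17–21] -/
def Psi (ν : ℝ) (χ : ℝ → ℝ) (r : ℝ) (z0 : ℝ × E3) (t : ℝ) (x : E3) : ℝ :=
  ∫ σ in (0 : ℝ)..r, σ * Phi ν χ σ z0 t x

/-- `∇Ψ_{r,z0}(·,t)` at `x` (spatial gradient). [cite: Taghizadeh2026, §2.5 p.5 l.22–25] -/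
def gradPsi (ν : ℝ) (χ : ℝ → ℝ) (r : ℝ) (z0 : ℝ × E3) (t : ℝ) (x : E3) : E3 :=
  gradient (fun y => Psi ν χ r z0 t y) x

/-- `∇ log Φ_{r,z0}(·,t)` at `x`, typed as `Φ⁻¹ ∇Φ` (junk `0` where `Φ = 0`; on `Q_{R/2}(0)` the text uses
`Φ_{R,0} = G_0 > 0` and «∇ log G_0(x,t) = −x/(2ν(−t))», p.11 l.24–28). [cite: Taghizadeh2026, §2.9 p.6 l.38–44; §4.3 p.11 l.24–28] -/
def gradLogPhi (ν : ℝ) (χ : ℝ → ℝ) (r : ℝ) (z0 : ℝ × E3) (t : ℝ) (x : E3) : E3 :=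
  (Phi ν χ r z0 t x)⁻¹ • gradient (fun y => Phi ν χ r z0 t y) x

/-- The rank-one map `u ⊗ w : v ↦ ⟪w, v⟫ u` (the print's `u ⊗ ∇ log Φ`, §2.9 p.6 l.38–44 / (1) p.10 l.57–60).
[cite: Taghizadeh2026, §2.9 p.6 l.38–44] -/
def tensor (a w : E3) : E3 →L[ℝ] E3 :=
  (innerSL ℝ w).smulRight a

/-- «Localized dissipation» `E1(r; z0) = (1/r) ∫∫_{Q_r(z0)} |∇u|² Φ_{r,z0}` (§2.6 p.5 l.46–52), with `∇u = G`.
[cite: Taghizadeh2026, §2.6 p.5 l.46–52] -/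
def E1 (ν : ℝ) (χ : ℝ → ℝ) (r : ℝ) (z0 : ℝ × E3) (G : ℝ → E3 → E3 →L[ℝ] E3) : ℝ :=
  r⁻¹ * ∫ z in parabolicCylinder r z0, frobeniusNormSq (G z.1 z.2) * Phi ν χ r z0 z.1 z.2

/-- The weighted mean `(u)_{r,z0} = (∫∫_{Q_r} u Φ)/(∫∫_{Q_r} Φ)` (§2.6 p.5 l.60–66). [cite: Taghizadeh2026, §2.6 p.5 l.60–66] -/
def wmean (ν : ℝ) (χ : ℝ → ℝ) (r : ℝ) (z0 : ℝ × E3) (u : ℝ → E3 → E3) : E3 :=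
  (∫ z in parabolicCylinder r z0, Phi ν χ r z0 z.1 z.2)⁻¹ •
    ∫ z in parabolicCylinder r z0, Phi ν χ r z0 z.1 z.2 • u z.1 z.2

/-- «Fluctuation energy» `E^fluc_0(r; z0) = (1/r³) ∫∫_{Q_r(z0)} |u − (u)_{r,z0}|² Φ_{r,z0}` (§2.6 p.5 l.53–66).
[cite: Taghizadeh2026, §2.6 p.5 l.53–66] -/
def Efluc (ν : ℝ) (χ : ℝ → ℝ) (r : ℝ) (z0 : ℝ × E3) (u : ℝ → E3 → E3) : ℝ :=
  (r ^ 3)⁻¹ * ∫ z in parabolicCylinder r z0, ‖u z.1 z.2 - wmean ν χ r z0 u‖ ^ 2 * Phi ν χ r z0 z.1 z.2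

/-- «Flux corrector» `C(r; z0) = (1/r²) ∫∫_{Q_r(z0)} (p + ½|u|²) u · ∇Ψ_{r,z0}` (§2.6 p.5 l.67–85).
[cite: Taghizadeh2026, §2.6 p.5 l.67–85] -/
def Cflux (ν : ℝ) (χ : ℝ → ℝ) (r : ℝ) (z0 : ℝ × E3) (u : ℝ → E3 → E3) (p : ℝ → E3 → ℝ) : ℝ :=
  (r ^ 2)⁻¹ * ∫ z in parabolicCylinder r z0,
    (p z.1 z.2 + (1 / 2 : ℝ) * ‖u z.1 z.2‖ ^ 2) * ⟪u z.1 z.2, gradPsi ν χ r z0 z.1 z.2⟫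

/-- «Harmonic pressure corrector» `C_harm(r; z0) = ∫∫_{Q_r(z0)} p ∇·W_r` (§2.8 p.6 l.5–35) with the PRINTED identity
«∇ · W_r = (1/r²) u · ∇Ψ_{r,z0}» (p.6 l.29–31) substituted — the Bogovskiĭ field `W_r` itself drops out of the
VALUE (Lemma 3.1's proof, p.8 l.89–94, reads `C_harm` the same way: «a bilinear pairing of p and u against the fixed
coefficient field ∇Ψ_{R,0}»). [cite: Taghizadeh2026, §2.8 p.6 l.5–35; Lemma 3.1 p.8 l.89–94] -/
def Charm (ν : ℝ) (χ : ℝ → ℝ) (r : ℝ) (z0 : ℝ × E3) (u : ℝ → E3 → E3) (p : ℝ → E3 → ℝ) : ℝ :=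
  (r ^ 2)⁻¹ * ∫ z in parabolicCylinder r z0, p z.1 z.2 * ⟪u z.1 z.2, gradPsi ν χ r z0 z.1 z.2⟫

/-- **The local monotonicity functional** `I(r; z0) = E1 + λ E^fluc_0 − C − C_harm` (§2.6 p.5 l.38–45), parameters
`ν`, `λ`, `χ`; arguments the scale `r`, the point `z0`, and the triple `(u, p, ∇u = G)`.
[cite: Taghizadeh2026, §2.6 p.5 l.38–45] -/
def Ifun (ν lam : ℝ) (χ : ℝ → ℝ) (r : ℝ) (z0 : ℝ × E3) (u : ℝ → E3 → E3) (p : ℝ → E3 → ℝ)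
    (G : ℝ → E3 → E3 →L[ℝ] E3) : ℝ :=
  E1 ν χ r z0 G + lam * Efluc ν χ r z0 u - Cflux ν χ r z0 u p - Charm ν χ r z0 u p

/-- **The dissipation square term** `D(ρ; z0) = ∫∫_{Q_ρ(z0)} |∇u − u ⊗ ∇ log Φ_{ρ,z0}|² Φ_{ρ,z0}` (§2.9 p.6
l.38–44 inside the almost-monotonicity display; named `D` in §4.1 p.9 l.59 / p.10 l.19–26).
[cite: Taghizadeh2026, §2.9 p.6 l.38–44; §4.1 p.10 l.19–26] -/
def Dfun (ν : ℝ) (χ : ℝ → ℝ) (ρ : ℝ) (z0 : ℝ × E3) (u : ℝ → E3 → E3) (G : ℝ → E3 → E3 →L[ℝ] E3) : ℝ :=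
  ∫ z in parabolicCylinder ρ z0,
    frobeniusNormSq (G z.1 z.2 - tensor (u z.1 z.2) (gradLogPhi ν χ ρ z0 z.1 z.2)) * Phi ν χ ρ z0 z.1 z.2

/-! ### §3.2 p.7 — the Navier–Stokes rescaling about `z0 = (t0, x0)` at scale `r`:
`u^{(r)}(x,t) = r u(x0 + r x, t0 + r² t)`, `p^{(r)} = r² p(…)`, `∇u^{(r)} = r² (∇u)(…)` -/

/-- Rescaled velocity (§3.2 p.7 l.42–53). [cite: Taghizadeh2026, §3.2 p.7 l.42–53] -/
def rescaleU (z0 : ℝ × E3) (r : ℝ) (u : ℝ → E3 → E3) (t : ℝ) (x : E3) : E3 :=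
  r • u (z0.1 + r ^ 2 * t) (z0.2 + r • x)

/-- Rescaled pressure (§3.2 p.7 l.42–53). [cite: Taghizadeh2026, §3.2 p.7 l.42–53] -/
def rescaleP (z0 : ℝ × E3) (r : ℝ) (p : ℝ → E3 → ℝ) (t : ℝ) (x : E3) : ℝ :=
  r ^ 2 * p (z0.1 + r ^ 2 * t) (z0.2 + r • x)

/-- Rescaled gradient `∇u^{(r)} = r² (∇u)(x0 + r x, t0 + r² t)` (chain rule on §3.2). [cite: Taghizadeh2026, §3.2 p.7 l.42–53] -/
def rescaleG (z0 : ℝ × E3) (r : ℝ) (G : ℝ → E3 → E3 →L[ℝ] E3) (t : ℝ) (x : E3) : E3 →L[ℝ] E3 :=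
  r ^ 2 • G (z0.1 + r ^ 2 * t) (z0.2 + r • x)

/-- The space-time origin `(0, 0)` (centre of the blow-up cylinders `Q_R(0)`, §3.3 p.8 l.1–5). [cite: Taghizadeh2026, §3.3 p.8 l.1–5] -/
def orig : ℝ × E3 := (0, 0)

/-! ### Convergence notions of §3.5 / Lemma 3.1 p.8 («on every compact K ⊂ R³ × (−∞, 0]») -/

/-- `u_k → u*` strongly in `L²(K)` (p.8 l.36–44, l.63–67). [cite: Taghizadeh2026, Lemma 3.1 p.8 l.63–67] -/
def StrongL2On (K : Set (ℝ × E3)) (uk : ℕ → ℝ → E3 → E3) (us : ℝ → E3 → E3) : Prop :=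
  Tendsto (fun k => ∫⁻ z in K, ‖uk k z.1 z.2 - us z.1 z.2‖ₑ ^ 2) atTop (𝓝 0)

/-- `∇u_k ⇀ ∇u*` weakly in `L²(K)` (p.8 l.30–34, l.67–69): convergence of every matrix entry against every
`L²(K)` test function. [cite: Taghizadeh2026, Lemma 3.1 p.8 l.67–69] -/
def WeakL2GradOn (K : Set (ℝ × E3)) (Gk : ℕ → ℝ → E3 → E3 →L[ℝ] E3) (Gs : ℝ → E3 → E3 →L[ℝ] E3) : Prop :=
  ∀ ψ : ℝ × E3 → ℝ, (∫⁻ z in K, ‖ψ z‖ₑ ^ 2) < ⊤ → ∀ v w : E3,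
    Tendsto (fun k => ∫ z in K, ψ z * ⟪Gk k z.1 z.2 v, w⟫) atTop (𝓝 (∫ z in K, ψ z * ⟪Gs z.1 z.2 v, w⟫))

/-- `p_k ⇀ p*` weakly in `L^{3/2}(K)` (p.8 l.45–51, l.69–71): convergence against every `L³(K)` test function.
[cite: Taghizadeh2026, Lemma 3.1 p.8 l.69–71] -/
def WeakL32On (K : Set (ℝ × E3)) (pk : ℕ → ℝ → E3 → ℝ) (ps : ℝ → E3 → ℝ) : Prop :=
  ∀ ψ : ℝ × E3 → ℝ, (∫⁻ z in K, ‖ψ z‖ₑ ^ 3) < ⊤ →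
    Tendsto (fun k => ∫ z in K, ψ z * pk k z.1 z.2) atTop (𝓝 (∫ z in K, ψ z * ps z.1 z.2))

/-- The three convergences of §3.5 / Lemma 3.1 on every compact subset of the closed past.
[cite: Taghizadeh2026, §3.5 p.8 l.27–51; Lemma 3.1 p.8 l.62–71] -/
def ConvergesTo (uk : ℕ → ℝ → E3 → E3) (pk : ℕ → ℝ → E3 → ℝ) (Gk : ℕ → ℝ → E3 → E3 →L[ℝ] E3)
    (us : ℝ → E3 → E3) (ps : ℝ → E3 → ℝ) (Gs : ℝ → E3 → E3 →L[ℝ] E3) : Prop :=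
  ∀ K ⊆ pastClosed, IsCompact K → StrongL2On K uk us ∧ WeakL2GradOn K Gk Gs ∧ WeakL32On K pk ps

/-! ### The paper's steps (no assertion). Every step is parametrised by `ν` (viscosity), `lam` (the «universal»
`λ` of §2.6) and the cutoff `χ`; hypotheses `0 < ν`, `0 < lam`, `IsCutoff χ` are part of each statement. -/

/-- **§2.7 p.6 l.1–4 «Normalization»**: «If u ≡ constant and p ≡ constant, then I(r; z0) ≡ 0 for all r > 0.»
(with `∇u = 0`). TRUE-type (every term carries `∇u`, `u − (u)_r = 0`, or `∫_x ∇Ψ = 0`); recorded as the object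
§3.6 / §4.4 invoke. [cite: Taghizadeh2026, §2.7 p.6 l.1–4] -/
def Step27_Normalisation (ν lam : ℝ) (χ : ℝ → ℝ) : Prop :=
  0 < ν → 0 < lam → IsCutoff χ → ∀ (a : E3) (b : ℝ) (z0 : ℝ × E3) (r : ℝ), 0 < r →
    Ifun ν lam χ r z0 (fun _ _ => a) (fun _ _ => b) (fun _ _ => 0) = 0

/-- **§2.9 p.6 l.36–56 «Almost-Monotonicity» (IMPORTED from the companion: (63)/(64) p.16 l.46–65, resting there on
Lemma 7.1 (ERR-SUM) (62) p.16 l.34–45)**, AS PRINTED HERE: «There exist constants c, C, α > 0 such that, for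
sufficiently small r, d/dr I(r; z0) ≥ c (1/r)∫∫_{Q_r(z0)} |∇u − u ⊗ ∇ log Φ_{r,z0}|² Φ_{r,z0} dx dt − Cr^α. In
particular, d/dr I(r; z0) ≥ −Cr^α, and the limit I0(z0) := lim_{r↓0} I(r; z0) exists for every spacetime point.»
— typed in the INTEGRATED form that §3.1 p.7 l.34–38 and §4.1 p.9 l.49 – p.10 l.6 consume («apply the
almost-monotonicity inequality … at scales r = r_kρ, integrate in ρ»; Lemma 2.1 p.7 supplies the absolutely
continuous representative): for every solution of the class and every `z0` in the slab there are `c, C, α, r* > 0`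
(typed AFTER the solution and the point — the weakest reading of «There exist constants»; the companion's Lemma
7.1 makes `C, α` depend on an `η > 0`) with the scale-difference inequality on `(0, r*)` and a limit at `0⁺`.
[claim: Taghizadeh2026, status: disputed] [cite: TaghizadehReduction2026, (63)–(64) p.16 l.46–65] -/
def Step29_AlmostMono (ν lam : ℝ) (χ : ℝ → ℝ) : Prop :=
  0 < ν → 0 < lam → IsCutoff χ → ∀ (T : ℝ) (u : ℝ → E3 → E3) (p : ℝ → E3 → ℝ) (G : ℝ → E3 → E3 →L[ℝ] E3),
    IsSolution ν T u p G → ∀ z0 : ℝ × E3, z0 ∈ (slab T : Set (ℝ × E3)) →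
      ∃ c C α rs : ℝ, 0 < c ∧ 0 < C ∧ 0 < α ∧ 0 < rs ∧
        (∀ r₁ r₂ : ℝ, 0 < r₁ → r₁ < r₂ → r₂ < rs →
          c * (∫ ρ in r₁..r₂, ρ⁻¹ * Dfun ν χ ρ z0 u G) - C * (∫ ρ in r₁..r₂, ρ ^ α) ≤
            Ifun ν lam χ r₂ z0 u p G - Ifun ν lam χ r₁ z0 u p G) ∧
        ∃ L : ℝ, Tendsto (fun r => Ifun ν lam χ r z0 u p G) (𝓝[>] 0) (𝓝 L)

/-- **§3.2 p.7 l.39–53 — the rescaled pair is a solution**: «Each pair (u^{(k)}, p^{(k)}) is a suitable weak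
solution of the Navier–Stokes equations on R³ × (−r_k^{−2} t0, 0].» — typed for every scale `r > 0` about a point of
the slab: the rescaled triple is CKN-suitable on `(−t0/r², 0) × ℝ³` with `∇u^{(r)} = G^{(r)}`. TRUE-type (change of
variables `x = x0 + r y`, `t = t0 + r² s` in the weak formulation and the local energy inequality).
[cite: Taghizadeh2026, §3.2 p.7 l.39–53; §2.3 p.4 l.70–76] -/
def Step32_Rescale (ν : ℝ) : Prop :=
  0 < ν → ∀ (T : ℝ) (u : ℝ → E3 → E3) (p : ℝ → E3 → ℝ) (G : ℝ → E3 → E3 →L[ℝ] E3),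
    IsSolution ν T u p G → ∀ z0 : ℝ × E3, z0 ∈ (slab T : Set (ℝ × E3)) → ∀ r : ℝ, 0 < r →
      IsSuitableWeakSolutionOn ⟨Ioo (-(z0.1 / r ^ 2)) 0 ×ˢ univ, isOpen_Ioo.prod isOpen_univ⟩ ν 0
          (rescaleU z0 r u) (rescaleP z0 r p) ∧
      HasWeakSpatialGradientOn ⟨Ioo (-(z0.1 / r ^ 2)) 0 ×ˢ univ, isOpen_Ioo.prod isOpen_univ⟩
          (rescaleU z0 r u) (rescaleG z0 r G)

/-- **§3.3 p.8 l.1–5 «Scale Invariance of the Monotonicity Functional»** («By construction and scale invariance,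
I^{(k)}(1; 0) = I(r_k; z0)»; announced §2.3 p.4 l.76–78 «All quantities introduced below are invariant under this
scaling»; used again §3.7 p.9 l.18–20 «By scale invariance, I^{(k)}(R; 0) = I(r_k R; z0)» and §4.1 p.9 l.49–50 «use
scale invariance» for BOTH `I` and `D`), AS PRINTED: for every scale `r > 0` and radius `R > 0` with `Q_{rR}(z0)`
under the slab, `I^{(r)}(R; 0) = I(rR; z0)` and `D^{(r)}(R; 0) = D(rR; z0)`. TYPIST'S BOOKKEEPING NOTE (on the typed
objects, which follow §2.4–§2.6 verbatim — un-normalised `G_{z0}` p.4 l.80–88, the print's own bullet «Φ_{r,z0} ∼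
r^{−3} on Q_r(z0)» p.5 l.12; status is the refuter's call, not adjudicated here): under `(t, x) = (t0 + r²s, x0 +
r y)` one has `Φ_{rR,z0}(t,x) = r^{−3} Φ_{R,0}(s,y)`, `∇Ψ_{R,0}(s,y) = r² ∇Ψ_{rR,z0}(t,x)`, whence `E1^{(r)}(R;0) =
r³ E1(rR; z0)`, `E^{fluc,(r)}_0(R;0) = r³ E^fluc_0(rR; z0)`, `C^{(r)}(R;0) = r² C(rR; z0)`, `C_harm^{(r)}(R;0) = r²
C_harm(rR; z0)`, `D^{(r)}(R;0) = r² D(rR; z0)`. [claim: Taghizadeh2026, status: disputed] -/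
def Step33_ScaleInvariance (ν lam : ℝ) (χ : ℝ → ℝ) : Prop :=
  0 < ν → 0 < lam → IsCutoff χ → ∀ (T : ℝ) (u : ℝ → E3 → E3) (p : ℝ → E3 → ℝ) (G : ℝ → E3 → E3 →L[ℝ] E3),
    IsSolution ν T u p G → ∀ z0 : ℝ × E3, z0 ∈ (slab T : Set (ℝ × E3)) → ∀ r : ℝ, 0 < r →
      ∀ R : ℝ, 0 < R → (r * R) ^ 2 ≤ z0.1 →
        Ifun ν lam χ R orig (rescaleU z0 r u) (rescaleP z0 r p) (rescaleG z0 r G) = Ifun ν lam χ (r * R) z0 u p G ∧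
        Dfun ν χ R orig (rescaleU z0 r u) (rescaleG z0 r G) = Dfun ν χ (r * R) z0 u G

/-- **§3.4 p.8 l.10–26 «Uniform Local Energy Bounds», AT THE SOLUTION GRAIN** (the objects are the rescaled fields
`u^{(k)}` of a solution of the class about a point of the slab, along scales `r_k ↓ 0`, under «I^{(k)}(1; 0) ≤ C for
all k» of §3.3 p.8 l.6–9): «From the definition of I and the nonnegativity of its coercive components, it follows
that ∫∫_{Q1(0)} |∇u^{(k)}|² dx dt ≤ C, ∫∫_{Q1(0)} |u^{(k)}|² dx dt ≤ C.» (the printed `C` is generic; typed as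
SOME bound uniform in `k`). The second sentence «By translation invariance, the same bounds hold on every compact
subset of R³ × (−∞, 0]» is recorded in `Step35_Compactness`'s hypothesis shape. Note for the refuter: `I` carries
the SIGNED terms `−C − C_harm` (§2.6). [claim: Taghizadeh2026, status: disputed] -/
def Step34_Bounds (ν lam : ℝ) (χ : ℝ → ℝ) : Prop :=
  0 < ν → 0 < lam → IsCutoff χ → ∀ (T : ℝ) (u : ℝ → E3 → E3) (p : ℝ → E3 → ℝ) (G : ℝ → E3 → E3 →L[ℝ] E3),
    IsSolution ν T u p G → ∀ z0 : ℝ × E3, z0 ∈ (slab T : Set (ℝ × E3)) →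
      ∀ rk : ℕ → ℝ, (∀ k, 0 < rk k) → (∀ k, rk k ^ 2 ≤ z0.1) → Tendsto rk atTop (𝓝 0) →
        ∀ C : ℝ, (∀ k, Ifun ν lam χ 1 orig (rescaleU z0 (rk k) u) (rescaleP z0 (rk k) p) (rescaleG z0 (rk k) G) ≤ C) →
          ∃ C' : ℝ, ∀ k,
            (∫ z in parabolicCylinder 1 orig, frobeniusNormSq (rescaleG z0 (rk k) G z.1 z.2)) ≤ C' ∧
            (∫ z in parabolicCylinder 1 orig, ‖rescaleU z0 (rk k) u z.1 z.2‖ ^ 2) ≤ C'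

/-- **§3.4 p.8 l.10–26 at the grain of its printed JUSTIFICATION (FAILURE-MODES F15)** — «From the definition of I
and the nonnegativity of its coercive components, it follows that …»: the inference uses nothing about the fields
except the definition of `I`, i.e. it is the sentence: for every bound `C` there is `C'` such that every ancient
suitable weak solution with `I(1; 0) ≤ C` has `∫∫_{Q1(0)} |∇u|² ≤ C'` and `∫∫_{Q1(0)} |u|² ≤ C'`. FUNCTIONS-type face
= the refuter's kernel handle; NOT consumed by the composition (v1.42 hazard (d): a kill by the print's own
normalisation objects — constants — must say why it is print-class). [claim: Taghizadeh2026, status: disputed] -/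
def Step34F_Bounds (ν lam : ℝ) (χ : ℝ → ℝ) : Prop :=
  0 < ν → 0 < lam → IsCutoff χ → ∀ C : ℝ, ∃ C' : ℝ,
    ∀ (u : ℝ → E3 → E3) (p : ℝ → E3 → ℝ) (G : ℝ → E3 → E3 →L[ℝ] E3), IsAncient ν u p G →
      Ifun ν lam χ 1 orig u p G ≤ C →
        (∫ z in parabolicCylinder 1 orig, frobeniusNormSq (G z.1 z.2)) ≤ C' ∧
        (∫ z in parabolicCylinder 1 orig, ‖u z.1 z.2‖ ^ 2) ≤ C'

/-- **§3.5 p.8 l.27–57 «Compactness and Extraction of an Ancient Limit»**: «By standard compactness results for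
suitable weak solutions, there exists a subsequence, not relabeled, such that u^{(k)} ⇀ u* weakly in
L²_loc(R₋; H¹_loc(R³)), and u^{(k)} → u* strongly in L²_loc(R₋; L²_loc(R³)). The pressures converge weakly, p^{(k)} ⇀
p* in L^{3/2}_loc(R³ × R₋). The limit (u*, p*) is a suitable weak solution on R³ × (−∞, 0], and hence an ancient
solution.» — typed for the rescaled sequence of a solution of the class under the uniform bounds of §3.4 «on every
compact subset» (p.8 l.25–26). Classical-type modulo the class (Aubin–Lions + CKN/Lin passage to the limit in the
local energy inequality). [claim: Taghizadeh2026, status: disputed] -/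
def Step35_Compactness (ν lam : ℝ) (χ : ℝ → ℝ) : Prop :=
  0 < ν → 0 < lam → IsCutoff χ → ∀ (T : ℝ) (u : ℝ → E3 → E3) (p : ℝ → E3 → ℝ) (G : ℝ → E3 → E3 →L[ℝ] E3),
    IsSolution ν T u p G → ∀ z0 : ℝ × E3, z0 ∈ (slab T : Set (ℝ × E3)) →
      ∀ rk : ℕ → ℝ, (∀ k, 0 < rk k) → Tendsto rk atTop (𝓝 0) →
        (∀ K ⊆ pastClosed, IsCompact K → ∃ CK : ℝ, ∀ᶠ k in atTop,
          (∫ z in K, frobeniusNormSq (rescaleG z0 (rk k) G z.1 z.2)) ≤ CK ∧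
          (∫ z in K, ‖rescaleU z0 (rk k) u z.1 z.2‖ ^ 2) ≤ CK) →
        ∃ φ : ℕ → ℕ, StrictMono φ ∧ ∃ (us : ℝ → E3 → E3) (ps : ℝ → E3 → ℝ) (Gs : ℝ → E3 → E3 →L[ℝ] E3),
          IsAncient ν us ps Gs ∧
          ConvergesTo (fun k => rescaleU z0 (rk (φ k)) u) (fun k => rescaleP z0 (rk (φ k)) p)
            (fun k => rescaleG z0 (rk (φ k)) G) us ps Gs

/-- **Lemma 3.1 p.8 l.58–102 «Stability of I under blow-up convergence», VERBATIM**: «Let (u^{(k)}, p^{(k)}) be suitable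
weak solutions on R³ × (−∞, 0] such that, on every compact K ⊂ R³ × (−∞, 0], u^{(k)} → u* strongly in L²(K), ∇u^{(k)}
⇀ ∇u* weakly in L²(K), p^{(k)} ⇀ p* weakly in L^{3/2}(K). Fix any R > 0. Then I^{(k)}(R; 0) → I*(R; 0).» — for ANY such
sequence of ancient suitable weak solutions and any triple `(u*, p*, ∇u* = G*)` (`G*` a weak spatial gradient of
`u*` on the past — the minimal sense of «∇u*»). Printed proof: «The dissipation term E1 is lower semicontinuous under
weak L² convergence of ∇u^{(k)}. The fluctuation term … continuous … The flux and harmonic corrector terms are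
continuous … Combining these gives the claim.» CARD-PREDICTED candidate (P2). [claim: Taghizadeh2026, status: disputed] -/
def StepL31_Stability (ν lam : ℝ) (χ : ℝ → ℝ) : Prop :=
  0 < ν → 0 < lam → IsCutoff χ →
    ∀ (uk : ℕ → ℝ → E3 → E3) (pk : ℕ → ℝ → E3 → ℝ) (Gk : ℕ → ℝ → E3 → E3 →L[ℝ] E3)
      (us : ℝ → E3 → E3) (ps : ℝ → E3 → ℝ) (Gs : ℝ → E3 → E3 →L[ℝ] E3),
      (∀ k, IsAncient ν (uk k) (pk k) (Gk k)) → HasWeakSpatialGradientOn past us Gs →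
        ConvergesTo uk pk Gk us ps Gs →
          ∀ R : ℝ, 0 < R →
            Tendsto (fun k => Ifun ν lam χ R orig (uk k) (pk k) (Gk k)) atTop (𝓝 (Ifun ν lam χ R orig us ps Gs))

/-- **«A positive monotonicity limit at `z0`»** (§3.1 p.7 l.26–33): a solution of the class on `(0,T) × ℝ³`, a point
of the slab, and `I(r; z0) → ε0 > 0` as `r ↓ 0`. [cite: Taghizadeh2026, §3.1 p.7 l.26–33] -/
def HasPositiveLimit (ν lam : ℝ) (χ : ℝ → ℝ) (T : ℝ) (u : ℝ → E3 → E3) (p : ℝ → E3 → ℝ)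
    (G : ℝ → E3 → E3 →L[ℝ] E3) (z0 : ℝ × E3) (ε0 : ℝ) : Prop :=
  IsSolution ν T u p G ∧ z0 ∈ (slab T : Set (ℝ × E3)) ∧ 0 < ε0 ∧
    Tendsto (fun r => Ifun ν lam χ r z0 u p G) (𝓝[>] 0) (𝓝 ε0)

/-- **The blow-up limit of §3.7–§3.8 / §4.1** (p.9 l.29–35 «an ancient suitable weak solution whose monotonicity
functional is strictly positive and constant across all scales»; p.10 l.7–18 «the exact inequality I*(R2; 0) −
I*(R1; 0) ≥ c ∫_{R1}^{R2} (1/ρ) D*(ρ; 0) dρ»). [cite: Taghizadeh2026, §3.7–§3.8 p.9 l.14–35; §4.1 p.10 l.7–26] -/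
def IsRigidLimit (ν lam : ℝ) (χ : ℝ → ℝ) (us : ℝ → E3 → E3) (ps : ℝ → E3 → ℝ)
    (Gs : ℝ → E3 → E3 →L[ℝ] E3) (ε0 : ℝ) : Prop :=
  IsAncient ν us ps Gs ∧ (∀ R : ℝ, 0 < R → Ifun ν lam χ R orig us ps Gs = ε0) ∧
    ∃ c : ℝ, 0 < c ∧ ∀ R₁ R₂ : ℝ, 0 < R₁ → R₁ < R₂ →
      c * (∫ ρ in R₁..R₂, ρ⁻¹ * Dfun ν χ ρ orig us Gs) ≤ Ifun ν lam χ R₂ orig us ps Gs - Ifun ν lam χ R₁ orig us ps Gs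

/-- **§3.6–§3.7 p.9 l.1–31 «Nontriviality» and «Diagonal Scale Selection»** (with §3.2 p.7 l.40–41 «Let {r_k} be a
sequence satisfying r_k ↓ 0, I(r_k; z0) → ε0» and §3.5): «By Lemma 3.1 applied at R = 1, we have I*(1; 0) = lim
I^{(k)}(1; 0) = ε0 > 0 … Fix R ∈ Q₊. Using the existence of the limit I0(z0), we may refine the sequence {r_k} so
that I(r_kR; z0) → ε0 for all R ∈ Q₊. By scale invariance, I^{(k)}(R; 0) = I(r_kR; z0) → ε0. Passing to the limit
yields I*(R; 0) = ε0 for all R ∈ Q₊. By Lemma 2.1 … the map R ↦ I*(R; 0) is continuous … we conclude I*(R; 0) = ε0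
for all R > 0.» — typed as the implication the section asserts: a positive limit at a point of the slab yields blow-up
scales `r_k ↓ 0` and an ANCIENT suitable weak solution, limit of the rescaled sequence in the sense of §3.5, with
`I*(R; 0) = ε0` for every `R > 0`. PRINTED INPUTS: `Step32_Rescale`, `Step33_ScaleInvariance`, `Step34_Bounds`,
`Step35_Compactness`, `StepL31_Stability` (at §3.6 l.2 and §3.7 l.21; note Lemma 3.1 is printed for solutions on
the WHOLE past while each `u^{(k)}` lives on `(−t0/r_k², 0]`), `Step29_AlmostMono` with Lemma 2.1 p.7 (§3.7 l.25–27);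
the bookkeeping itself (refinement over `R ∈ Q₊`, continuity) is the paper's. [claim: Taghizadeh2026, status: disputed] -/
def Step37_PersistentValue (ν lam : ℝ) (χ : ℝ → ℝ) : Prop :=
  0 < ν → 0 < lam → IsCutoff χ → ∀ (T : ℝ) (u : ℝ → E3 → E3) (p : ℝ → E3 → ℝ) (G : ℝ → E3 → E3 →L[ℝ] E3)
    (z0 : ℝ × E3) (ε0 : ℝ), HasPositiveLimit ν lam χ T u p G z0 ε0 →
      ∃ rk : ℕ → ℝ, (∀ k, 0 < rk k) ∧ Tendsto rk atTop (𝓝 0) ∧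
        ∃ (us : ℝ → E3 → E3) (ps : ℝ → E3 → ℝ) (Gs : ℝ → E3 → E3 →L[ℝ] E3), IsAncient ν us ps Gs ∧
          ConvergesTo (fun k => rescaleU z0 (rk k) u) (fun k => rescaleP z0 (rk k) p)
            (fun k => rescaleG z0 (rk k) G) us ps Gs ∧
          ∀ R : ℝ, 0 < R → Ifun ν lam χ R orig us ps Gs = ε0

/-- **§4.1 p.9 l.43 – p.10 l.26 «Persistence of the Monotonicity Value» — the exact inequality**: «Fix 0 < R1 < R2.
Apply the almost-monotonicity inequality from Section 2 to the original solution at scales r = r_kρ with ρ ∈ [R1,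
R2], integrate in ρ, and use scale invariance. This yields, for each k, I^{(k)}(R2; 0) − I^{(k)}(R1; 0) ≥ c ∫_{R1}^{R2}
(1/ρ) D^{(k)}(ρ; 0) dρ − C ∫_{R1}^{R2} (r_kρ)^α dρ. … Passing k → ∞ and using Lemma 3.1 together with lower
semicontinuity of D^{(k)}(ρ; 0) gives the exact inequality I*(R2; 0) − I*(R1; 0) ≥ c ∫_{R1}^{R2} (1/ρ) D*(ρ; 0) dρ» —
typed in the §3 situation (original solution with a positive limit at `z0`, scales `r_k ↓ 0`, the rescaled sequence
converging in the sense of §3.5 to an ancient triple): the limit obeys the exact scale-difference inequality with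
SOME `c > 0`. PRINTED INPUTS: `Step29_AlmostMono` (at scales `r_kρ`), `Step33_ScaleInvariance` (for `I` and `D`),
`StepL31_Stability`, lower semicontinuity of `D` (asserted p.10 l.7, no proof). [claim: Taghizadeh2026, status: disputed] -/
def Step41_ExactInequality (ν lam : ℝ) (χ : ℝ → ℝ) : Prop :=
  0 < ν → 0 < lam → IsCutoff χ → ∀ (T : ℝ) (u : ℝ → E3 → E3) (p : ℝ → E3 → ℝ) (G : ℝ → E3 → E3 →L[ℝ] E3)
    (z0 : ℝ × E3) (ε0 : ℝ), HasPositiveLimit ν lam χ T u p G z0 ε0 →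
      ∀ rk : ℕ → ℝ, (∀ k, 0 < rk k) → Tendsto rk atTop (𝓝 0) →
        ∀ (us : ℝ → E3 → E3) (ps : ℝ → E3 → ℝ) (Gs : ℝ → E3 → E3 →L[ℝ] E3), IsAncient ν us ps Gs →
          ConvergesTo (fun k => rescaleU z0 (rk k) u) (fun k => rescaleP z0 (rk k) p)
            (fun k => rescaleG z0 (rk k) G) us ps Gs →
            ∃ c : ℝ, 0 < c ∧ ∀ R₁ R₂ : ℝ, 0 < R₁ → R₁ < R₂ →
              c * (∫ ρ in R₁..R₂, ρ⁻¹ * Dfun ν χ ρ orig us Gs) ≤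
                Ifun ν lam χ R₂ orig us ps Gs - Ifun ν lam χ R₁ orig us ps Gs

/-- **§3.8 p.9 l.32–35 with §4.1 — the package the paper carries into §4** («Under the assumption of a positive
monotonicity limit, we have constructed a nontrivial ancient suitable weak solution whose monotonicity functional is
strictly positive and constant across all scales» + the exact inequality of §4.1): a positive limit at a point
yields a rigid ancient limit with the same value `ε0`. DERIVED below (`package_of_steps`) from `Step37_PersistentValue`
and `Step41_ExactInequality`; kept as a named summary. [claim: Taghizadeh2026, status: disputed] -/
def Step3_Package (ν lam : ℝ) (χ : ℝ → ℝ) : Prop :=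
  0 < ν → 0 < lam → IsCutoff χ → ∀ (T : ℝ) (u : ℝ → E3 → E3) (p : ℝ → E3 → ℝ) (G : ℝ → E3 → E3 →L[ℝ] E3)
    (z0 : ℝ × E3) (ε0 : ℝ), HasPositiveLimit ν lam χ T u p G z0 ε0 →
      ∃ (us : ℝ → E3 → E3) (ps : ℝ → E3 → ℝ) (Gs : ℝ → E3 → E3 →L[ℝ] E3), IsRigidLimit ν lam χ us ps Gs ε0

/-- **§4.2 p.10 l.27–53 «Vanishing of the Dissipation Square Term»**: «Since I*(R; 0) ≡ ε0 is constant for all R > 0,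
the scale-difference inequality … yields 0 = I*(R2; 0) − I*(R1; 0) ≥ c ∫_{R1}^{R2} (1/ρ) D*(ρ; 0) dρ for every 0 < R1 <
R2, where D*(ρ; 0) ≥ 0. Hence … D*(ρ; 0) = 0 for a.e. ρ > 0.» TRUE-type (real analysis on a nonnegative integrand).
[cite: Taghizadeh2026, §4.2 p.10 l.27–53] -/
def Step42_Vanishing (ν lam : ℝ) (χ : ℝ → ℝ) : Prop :=
  0 < ν → 0 < lam → IsCutoff χ → ∀ (us : ℝ → E3 → E3) (ps : ℝ → E3 → ℝ) (Gs : ℝ → E3 → E3 →L[ℝ] E3) (ε0 : ℝ),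
    IsRigidLimit ν lam χ us ps Gs ε0 → ∀ᵐ ρ ∂(volume.restrict (Ioi (0 : ℝ))), Dfun ν χ ρ orig us Gs = 0

/-- **Lemma 4.1 p.10 l.71 – p.11 l.36 «Rigidity on an interior cylinder»**: «Let (u*, p*) be a suitable weak solution
on R³ × (−∞, 0]. Fix R > 0 such that D*(R; 0) = 0. Then u*(x, t) = 0 for a.e. (x, t) ∈ Q_{R/2}(0).» (printed proof via
(2) ∂ᵢu* = u* ∂ᵢlog G₀, v := u*/G₀, (3) ∂ᵢv = 0, (4) u* = G₀ a(t), incompressibility and «∇ log G0(x,t) =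
−x/(2ν(−t))» ⇒ a(t)·x = 0 ⇒ a = 0). TRUE-type reading. [cite: Taghizadeh2026, Lemma 4.1 p.10 l.71 – p.11 l.36] -/
def StepL41_Rigidity (ν : ℝ) (χ : ℝ → ℝ) : Prop :=
  0 < ν → IsCutoff χ → ∀ (us : ℝ → E3 → E3) (ps : ℝ → E3 → ℝ) (Gs : ℝ → E3 → E3 →L[ℝ] E3),
    IsAncient ν us ps Gs → ∀ R : ℝ, 0 < R → Dfun ν χ R orig us Gs = 0 →
      ∀ᵐ z ∂(volume.restrict (parabolicCylinder (R / 2) orig)), us z.1 z.2 = 0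

/-- **§4.4 p.11 l.37–54 «Contradiction with Nontriviality and Normalization», AS PRINTED** («Lemma 4.1 implies that u*
vanishes on the nontrivial interior cylinder Q_{R/2}(0) and hence is (locally) constant there. By the normalization
of the monotonicity functional, constant solutions satisfy I(R; 0) ≡ 0 for all R > 0, and therefore the ancient
limit must satisfy I*(1; 0) = 0»): for an ancient suitable weak solution vanishing a.e. on every interior cylinder
`Q_{R/2}(0)` (the print's `R` is any radius with `D*(R; 0) = 0`, i.e. a.e. `R > 0` by §4.2 — equivalently `u* = 0`
a.e. on the open past), `I*(1; 0) = 0`. The pressure `p*` is untouched by the print (v1.42 hazard (c)); as typed the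
inference is TRUE-type (every term of `I` carries a factor `u` or `∇u`, and `∇u* = 0` a.e. where `u* = 0` a.e.).
[cite: Taghizadeh2026, §4.4 p.11 l.37–54] -/
def Step44_Contradiction (ν lam : ℝ) (χ : ℝ → ℝ) : Prop :=
  0 < ν → 0 < lam → IsCutoff χ → ∀ (us : ℝ → E3 → E3) (ps : ℝ → E3 → ℝ) (Gs : ℝ → E3 → E3 →L[ℝ] E3),
    IsAncient ν us ps Gs →
      (∀ R : ℝ, 0 < R → ∀ᵐ z ∂(volume.restrict (parabolicCylinder (R / 2) orig)), us z.1 z.2 = 0) →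
        Ifun ν lam χ 1 orig us ps Gs = 0

/-- **IMPLICIT (unprinted), needed by §4.5 p.11 l.55–60** («The contradiction shows that the assumption ∃ z0 :
I0(z0) > 0 is false. Therefore, I0(z0) = 0 for all z0 ∈ R³ × (0, T).»): the limit `I0(z0)` of every solution of the
class at every point of the slab is NONNEGATIVE. No line of the text states or derives it (`I = E1 + λE^fluc_0 − C −
C_harm` has signed flux terms, §2.6 p.5; §2.9 bounds `dI/dr` from below only; §3.3 l.6 gives an upper bound); typed
as its own binder (README LEAN CONVENTIONS 4: a substantive unprinted implication is a named implicit Step, never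
a silent gap). Without it the printed chain yields only `I0(z0) ≤ 0`. [claim: Taghizadeh2026, status: disputed] -/
def Step45_NonnegLimit_implicit (ν lam : ℝ) (χ : ℝ → ℝ) : Prop :=
  0 < ν → 0 < lam → IsCutoff χ → ∀ (T : ℝ) (u : ℝ → E3 → E3) (p : ℝ → E3 → ℝ) (G : ℝ → E3 → E3 →L[ℝ] E3),
    IsSolution ν T u p G → ∀ z0 : ℝ × E3, z0 ∈ (slab T : Set (ℝ × E3)) →
      ∀ L : ℝ, Tendsto (fun r => Ifun ν lam χ r z0 u p G) (𝓝[>] 0) (𝓝 L) → 0 ≤ L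

/-! ### The claimed statements -/

/-- **Theorem 1.1 p.2 l.31–41 (= Theorem 5.1 p.12 l.31–37), AS PRINTED**, for the functional with parameters
`(ν, λ, χ)`: «Let (u, p) be a suitable weak solution … on R³ × (0, T). Then for every spacetime point z0, lim_{r↓0}
I(r; z0) = 0.» [claim: Taghizadeh2026, status: disputed] -/
def ClaimedTheorem (ν lam : ℝ) (χ : ℝ → ℝ) : Prop :=
  0 < ν → 0 < lam → IsCutoff χ → ∀ (T : ℝ) (u : ℝ → E3 → E3) (p : ℝ → E3 → ℝ) (G : ℝ → E3 → E3 →L[ℝ] E3),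
    IsSolution ν T u p G → ∀ z0 : ℝ × E3, z0 ∈ (slab T : Set (ℝ × E3)) →
      Tendsto (fun r => Ifun ν lam χ r z0 u p G) (𝓝[>] 0) (𝓝 0)

/-- **§5.3 p.12 l.40–48 «From Vanishing to Local Regularity» (IMPORTED from the companion: Proposition 9.1
«Reduction Principle» p.20 l.3–13, proved there in five lines via «the standard Caffarelli–Kohn–Nirenberg control
estimate» (76) A(r; z0) + B(r; z0) < ε0 and STATED there for the hypothesis at EVERY z0)**, AS PARAPHRASED HERE: «if
the monotonicity functional satisfies lim_{r↓0} I(r; z0) = 0 at a spacetime point z0, then that point is regular»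
(tree `IsRegularPoint`: `u` essentially bounded on a centred cylinder about `z0`). [claim: Taghizadeh2026, status: disputed]
[cite: TaghizadehReduction2026, Prop 9.1 p.20 l.3–13] -/
def Step53_Reduction (ν lam : ℝ) (χ : ℝ → ℝ) : Prop :=
  0 < ν → 0 < lam → IsCutoff χ → ∀ (T : ℝ) (u : ℝ → E3 → E3) (p : ℝ → E3 → ℝ) (G : ℝ → E3 → E3 →L[ℝ] E3),
    IsSolution ν T u p G → ∀ z0 : ℝ × E3, z0 ∈ (slab T : Set (ℝ × E3)) →
      Tendsto (fun r => Ifun ν lam χ r z0 u p G) (𝓝[>] 0) (𝓝 0) → IsRegularPoint u z0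

/-- **§5.4 p.13 l.2–3**: «Since every spacetime point is regular, suitable weak solutions are smooth on R³ × (0, T].»
— typed on the OPEN slab (`IsSmoothSpaceTimeOn (Ioo 0 T) u` after modification on a null set: there is a version
`v = u` a.e. on the slab, jointly smooth there). (Classical passage «locally bounded suitable weak solution ⇒ smooth»
= Serrin-type interior regularity; IN SPACE it is classical, joint space-time `C^∞` for weak solutions is NOT —
time regularity of the pressure; recorded as printed.) [claim: Taghizadeh2026, status: disputed] -/
def Step54_Smooth (ν : ℝ) : Prop :=
  0 < ν → ∀ (T : ℝ) (u : ℝ → E3 → E3) (p : ℝ → E3 → ℝ) (G : ℝ → E3 → E3 →L[ℝ] E3), IsSolution ν T u p G →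
    (∀ z0 : ℝ × E3, z0 ∈ (slab T : Set (ℝ × E3)) → IsRegularPoint u z0) →
      ∃ v : ℝ → E3 → E3, (∀ᵐ z ∂(volume.restrict (slab T : Set (ℝ × E3))), v z.1 z.2 = u z.1 z.2) ∧
        IsSmoothSpaceTimeOn (Ioo 0 T) v

/-- **The §5.3–§5.4 corollary as printed (p.12 l.46–48, p.13 l.2–3)**: every suitable weak solution of the class
is smooth (after modification on a null set) on the open slab. (The further sentence p.13 l.4–15 for `u0 ∈
C₀^∞` — «the corresponding solution … u ∈ C^∞(R³ × (0, ∞))» — and the Clay (A) form (smooth on [0,∞) with (7) from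
(4)-data) need the existence/identification bridge of the module docstring; not typed in this rev.)
[claim: Taghizadeh2026, status: disputed] -/
def ClaimedCorollary (ν lam : ℝ) (χ : ℝ → ℝ) : Prop :=
  0 < ν → 0 < lam → IsCutoff χ → ∀ (T : ℝ) (u : ℝ → E3 → E3) (p : ℝ → E3 → ℝ) (G : ℝ → E3 → E3 →L[ℝ] E3),
    IsSolution ν T u p G →
      ∃ v : ℝ → E3 → E3, (∀ᵐ z ∂(volume.restrict (slab T : Set (ℝ × E3))), v z.1 z.2 = u z.1 z.2) ∧
        IsSmoothSpaceTimeOn (Ioo 0 T) v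

/-! ### Kernel compositions (the paper's own implications; PROVED) -/

/-- **§3.8 from §3.7 and §4.1**: the persistent value and the exact inequality assemble the rigid ancient limit.
[cite: Taghizadeh2026, §3.8 p.9 l.32–35; §4.1 p.10 l.7–26] -/
theorem package_of_steps {ν lam : ℝ} {χ : ℝ → ℝ} (h37 : Step37_PersistentValue ν lam χ)
    (h41 : Step41_ExactInequality ν lam χ) : Step3_Package ν lam χ := by
  intro hν hlam hχ T u p G z0 ε0 hpl
  obtain ⟨rk, hrk, hrk0, us, ps, Gs, hanc, hconv, hconst⟩ := h37 hν hlam hχ T u p G z0 ε0 hpl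
  obtain ⟨c, hc, hineq⟩ := h41 hν hlam hχ T u p G z0 ε0 hpl rk hrk hrk0 us ps Gs hanc hconv
  exact ⟨us, ps, Gs, hanc, hconst, c, hc, hineq⟩

/-- **§4.2–§4.4 close the contradiction on a rigid limit**: a rigid ancient limit with value `ε0` has `I*(1;0) = ε0`
and, by Steps 42, L41, 44, `I*(1;0) = 0`; hence `ε0 = 0`. [cite: Taghizadeh2026, §4.2–§4.4 p.10–11] -/
theorem eps_eq_zero_of_rigid {ν lam : ℝ} {χ : ℝ → ℝ} (hν : 0 < ν) (hlam : 0 < lam) (hχ : IsCutoff χ)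
    (h42 : Step42_Vanishing ν lam χ) (h41 : StepL41_Rigidity ν χ) (h44 : Step44_Contradiction ν lam χ)
    {us : ℝ → E3 → E3} {ps : ℝ → E3 → ℝ} {Gs : ℝ → E3 → E3 →L[ℝ] E3} {ε0 : ℝ}
    (hrig : IsRigidLimit ν lam χ us ps Gs ε0) : ε0 = 0 := by
  have hanc : IsAncient ν us ps Gs := hrig.1
  have hconst := hrig.2.1
  -- §4.2: `D* = 0` for a.e. `ρ > 0`
  have hD : ∀ᵐ ρ ∂(volume.restrict (Ioi (0 : ℝ))), Dfun ν χ ρ orig us Gs = 0 := h42 hν hlam hχ us ps Gs ε0 hrig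
  -- §4.3: on every interior cylinder `Q_{R/2}(0)` the limit vanishes — via SOME `R' ≥ R` with `D*(R';0) = 0`
  have hvan : ∀ R : ℝ, 0 < R → ∀ᵐ z ∂(volume.restrict (parabolicCylinder (R / 2) orig)), us z.1 z.2 = 0 := by
    intro R hR
    -- a.e. vanishing on `(0,∞)` gives a good radius in `[R, R+1]`
    have hpos : 0 < volume (Icc R (R + 1) : Set ℝ) := by
      rw [Real.volume_Icc]; simp
    have hsub : (Icc R (R + 1) : Set ℝ) ⊆ Ioi 0 := fun ρ hρ => lt_of_lt_of_le hR hρ.1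
    have hD' : ∀ᵐ ρ ∂(volume.restrict (Icc R (R + 1))), Dfun ν χ ρ orig us Gs = 0 :=
      ae_restrict_of_ae_restrict_of_subset hsub hD
    obtain ⟨R', hR'mem, hR'D⟩ : ∃ R' ∈ Icc R (R + 1), Dfun ν χ R' orig us Gs = 0 := by
      by_contra hcon
      push Not at hcon
      have : ∀ᵐ ρ ∂(volume.restrict (Icc R (R + 1))), False := by
        filter_upwards [hD', ae_restrict_mem measurableSet_Icc] with ρ h1 h2 using hcon ρ h2 h1
      rw [ae_iff] at this
      simp only [not_false_eq_true, setOf_true, Measure.restrict_apply_univ] at this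
      exact absurd this hpos.ne'
    have hR'pos : 0 < R' := lt_of_lt_of_le hR hR'mem.1
    have hv := h41 hν hχ us ps Gs hanc R' hR'pos hR'D
    -- `Q_{R/2}(0) ⊆ Q_{R'/2}(0)`
    have hsubQ : parabolicCylinder (R / 2) orig ⊆ parabolicCylinder (R' / 2) orig := by
      intro z hz
      simp only [parabolicCylinder, orig, mem_prod, mem_Ioo, mem_ball] at hz ⊢
      refine ⟨⟨?_, hz.1.2⟩, lt_of_lt_of_le hz.2 (by linarith [hR'mem.1])⟩
      have : (R / 2) ^ 2 ≤ (R' / 2) ^ 2 := by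
        apply pow_le_pow_left₀ (by linarith) (by linarith [hR'mem.1])
      linarith [hz.1.1]
    exact ae_restrict_of_ae_restrict_of_subset hsubQ hv
  -- §4.4: `I*(1;0) = 0`, against `I*(1;0) = ε0`
  have h0 : Ifun ν lam χ 1 orig us ps Gs = 0 := h44 hν hlam hχ us ps Gs hanc hvan
  have h1 : Ifun ν lam χ 1 orig us ps Gs = ε0 := hconst 1 one_pos
  linarith

/-- **THEOREM 1.1 FROM THE PRINTED CHAIN, via the §3.8 package** (§3–§4 p.7–11): by §2.9 the limit `L = I0(z0)`
exists; if `L > 0`, §3 gives a rigid ancient limit with value `L`, and §4.2–§4.4 force `L = 0` — contradiction; so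
`L ≤ 0`; the IMPLICIT `Step45` (`L ≥ 0`, unprinted, needed by §4.5 l.58–60) closes `L = 0`. COMPOSES — with the
implicit binder exposed. [cite: Taghizadeh2026, §4.5 p.11 l.55–61; §5.1–5.2 p.12 l.8–39] -/
theorem claim_of_package {ν lam : ℝ} {χ : ℝ → ℝ}
    (h29 : Step29_AlmostMono ν lam χ) (h3 : Step3_Package ν lam χ) (h42 : Step42_Vanishing ν lam χ)
    (h41 : StepL41_Rigidity ν χ) (h44 : Step44_Contradiction ν lam χ)
    (h45 : Step45_NonnegLimit_implicit ν lam χ) : ClaimedTheorem ν lam χ := by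
  intro hν hlam hχ T u p G hsol z0 hz0
  obtain ⟨c, C, α, rs, -, -, -, -, -, L, hL⟩ := h29 hν hlam hχ T u p G hsol z0 hz0
  have hL0 : 0 ≤ L := h45 hν hlam hχ T u p G hsol z0 hz0 L hL
  rcases hL0.eq_or_lt with h | hpos
  · subst h; exact hL
  · exfalso
    obtain ⟨us, ps, Gs, hrig⟩ := h3 hν hlam hχ T u p G z0 L ⟨hsol, hz0, hpos, hL⟩
    have := eps_eq_zero_of_rigid hν hlam hχ h42 h41 h44 hrig
    linarith

/-- **THEOREM 1.1 FROM THE PRINTED CHAIN, fine binders** (§2.9, §3.7, §4.1, §4.2, Lemma 4.1, §4.4 + the implicit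
§4.5 binder). COMPOSES. [cite: Taghizadeh2026, §4.5 p.11 l.55–61; §5.1–5.2 p.12 l.8–39] -/
theorem claim_of_steps {ν lam : ℝ} {χ : ℝ → ℝ}
    (h29 : Step29_AlmostMono ν lam χ) (h37 : Step37_PersistentValue ν lam χ)
    (h41x : Step41_ExactInequality ν lam χ) (h42 : Step42_Vanishing ν lam χ)
    (h41 : StepL41_Rigidity ν χ) (h44 : Step44_Contradiction ν lam χ)
    (h45 : Step45_NonnegLimit_implicit ν lam χ) : ClaimedTheorem ν lam χ :=
  claim_of_package h29 (package_of_steps h37 h41x) h42 h41 h44 h45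

/-- **§5.3–§5.4 FROM THEOREM 1.1** (p.12 l.40–48, p.13 l.2–3): vanishing at every point + the reduction principle ⇒
every point regular ⇒ smooth on the open slab. COMPOSES. [cite: Taghizadeh2026, §5.3–§5.4 p.12 l.40 – p.13 l.3] -/
theorem corollary_of_steps {ν lam : ℝ} {χ : ℝ → ℝ} (hthm : ClaimedTheorem ν lam χ)
    (h53 : Step53_Reduction ν lam χ) (h54 : Step54_Smooth ν) : ClaimedCorollary ν lam χ := by
  intro hν hlam hχ T u p G hsol
  exact h54 hν T u p G hsol fun z0 hz0 => h53 hν hlam hχ T u p G hsol z0 hz0 (hthm hν hlam hχ T u p G hsol z0 hz0)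

/-- The whole printed chain to the corollary. [cite: Taghizadeh2026, §5 p.12–13] -/
theorem corollary_of_all_steps {ν lam : ℝ} {χ : ℝ → ℝ}
    (h29 : Step29_AlmostMono ν lam χ) (h37 : Step37_PersistentValue ν lam χ)
    (h41x : Step41_ExactInequality ν lam χ) (h42 : Step42_Vanishing ν lam χ)
    (h41 : StepL41_Rigidity ν χ) (h44 : Step44_Contradiction ν lam χ)
    (h45 : Step45_NonnegLimit_implicit ν lam χ) (h53 : Step53_Reduction ν lam χ) (h54 : Step54_Smooth ν) :
    ClaimedCorollary ν lam χ :=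
  corollary_of_steps (claim_of_steps h29 h37 h41x h42 h41 h44 h45) h53 h54

/-- Without the implicit binder the printed chain gives only `I0(z0) ≤ 0` (§4.5 p.11 l.55–58 proves exactly
«¬ (I0(z0) > 0)»). [cite: Taghizadeh2026, §4.5 p.11 l.55–58] -/
theorem limit_nonpos_of_steps {ν lam : ℝ} {χ : ℝ → ℝ}
    (h3 : Step3_Package ν lam χ) (h42 : Step42_Vanishing ν lam χ)
    (h41 : StepL41_Rigidity ν χ) (h44 : Step44_Contradiction ν lam χ)
    (hν : 0 < ν) (hlam : 0 < lam) (hχ : IsCutoff χ) {T : ℝ} {u : ℝ → E3 → E3} {p : ℝ → E3 → ℝ}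
    {G : ℝ → E3 → E3 →L[ℝ] E3} (hsol : IsSolution ν T u p G) {z0 : ℝ × E3} (hz0 : z0 ∈ (slab T : Set (ℝ × E3)))
    {L : ℝ} (hL : Tendsto (fun r => Ifun ν lam χ r z0 u p G) (𝓝[>] 0) (𝓝 L)) : L ≤ 0 := by
  by_contra hpos
  push Not at hpos
  obtain ⟨us, ps, Gs, hrig⟩ := h3 hν hlam hχ T u p G z0 L ⟨hsol, hz0, hpos, hL⟩
  have := eps_eq_zero_of_rigid hν hlam hχ h42 h41 h44 hrig
  linarith

/-! ### Clay link (reference `ClayVariants.lean`; CLAY-LINK keeper lit-4 g8). NOT a step of the paper. -/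

/-- **CLAY BRIDGE (Δ5; NOT printed)** — what the §5.4–§5.5 sentence «for all smooth divergence-free data … u ∈
C^∞(R³ × (0, ∞))» needs on top of the §5.3 corollary to reach Fefferman's (A): every Clay datum (smooth,
divergence free, class (4)) has a GLOBAL Leray–Hopf weak solution which, on every slab `(0, T)`, lies in the
§2.1 class (CKN-suitable with SOME pressure `p` and weak gradient `G`, global energy). Classical for Leray's
regularised solutions (Caffarelli–Kohn–Nirenberg 1982, Appendix: existence of suitable weak solutions from `L²`
data) but not in the tree in this vocabulary; typed ONLY as the hypothesis of `clayA_of_claimed` — it is the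
recorded delta, not a binder of the claim. [cite: CaffarelliKohnNirenberg1982, Appendix (existence of suitable weak solutions)] -/
def ClayBridge_SuitableLerayHopf (ν : ℝ) : Prop :=
  ∀ u₀ : E3 → E3, ContDiff ℝ ∞ u₀ → NSWave0.IsDivFree u₀ → HasRapidSpatialDecay u₀ →
    ∃ v : ℝ → E3 → E3, IsGlobalLerayHopf ν 0 u₀ v ∧
      ∀ T : ℝ, 0 < T → ∃ (p : ℝ → E3 → ℝ) (G : ℝ → E3 → E3 →L[ℝ] E3), IsSolution ν T v p G

/-- **Fefferman (A) at viscosity `ν` FROM Theorem 1.1 + §5.3, MODULO the bridge**: the suitable Leray–Hopf solution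
from a Clay datum is a regular point everywhere on every slab (Thm 1.1 + `Step53_Reduction`), hence essentially
bounded on a parabolic cylinder below every point `(T, x)`, `T > 0`, and the tree door
`clay_solution_of_locallyBounded_globalLerayHopf` (Kato maximal time + Lemarié-Rieusset singular point +
Clay-class weak–strong uniqueness) supplies the smooth solution on `[0, ∞)` with (6)–(7) — i.e. the `t = 0` layer
and the energy clause (Δ6) come from the tree, the datum/solution-class bridge (Δ5) is the named hypothesis.
[cite: FeffermanClay2006, (A) with (4) (6) (7) p. 2] [cite: Taghizadeh2026, §5.3–§5.4 p.12 l.40 – p.13 l.15] -/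
theorem clayA_of_claimed {ν lam : ℝ} {χ : ℝ → ℝ} (hν : 0 < ν) (hlam : 0 < lam) (hχ : IsCutoff χ)
    (hbridge : ClayBridge_SuitableLerayHopf ν) (hthm : ClaimedTheorem ν lam χ)
    (h53 : Step53_Reduction ν lam χ) : ClayVariants.clayR3.RegularityAt ν := by
  intro u₀ hu₀ hdiv hdec
  obtain ⟨v, hv, hsuit⟩ := hbridge u₀ hu₀ hdiv hdec
  have hbd : ∀ T : ℝ, 0 < T → ∀ x : E3, ∃ r : ℝ, 0 < r ∧
      eLpNorm (uncurry v) ⊤ (volume.restrict (parabolicCylinder r ((T : ℝ), x))) < ⊤ := by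
    intro T hT x
    obtain ⟨p, G, hsol⟩ := hsuit (T + 1) (by linarith)
    have hz : ((T, x) : ℝ × E3) ∈ (slab (T + 1) : Set (ℝ × E3)) :=
      show ((T, x) : ℝ × E3) ∈ Ioo 0 (T + 1) ×ˢ (univ : Set E3) from ⟨⟨hT, by linarith⟩, mem_univ _⟩
    obtain ⟨r, hr, hreg⟩ := h53 hν hlam hχ (T + 1) v p G hsol (T, x) hz
      (hthm hν hlam hχ (T + 1) v p G hsol (T, x) hz)
    have hsub : parabolicCylinder r ((T : ℝ), x) ⊆ parabolicCylinderCentered r ((T : ℝ), x) := by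
      intro z hz'
      simp only [parabolicCylinder, parabolicCylinderCentered, mem_prod, mem_Ioo, mem_ball] at hz' ⊢
      exact ⟨⟨hz'.1.1, by nlinarith [hz'.1.2, sq_nonneg r]⟩, hz'.2⟩
    exact ⟨r, hr, lt_of_le_of_lt (eLpNorm_mono_measure _ (Measure.restrict_mono hsub le_rfl)) hreg⟩
  obtain ⟨U, P, hU, hP, hns, hE⟩ := clay_solution_of_locallyBounded_globalLerayHopf hν hu₀ hdiv hdec hv hbd
  exact ⟨U, P, hU, hP, hns, hE⟩

/-- **Fefferman (A) (all viscosities) from the whole printed chain, modulo the bridge at every `ν`.**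
[cite: FeffermanClay2006, (A) p. 2] [cite: Taghizadeh2026, Thm 1.1 p.2 l.31–41; §5.3–§5.4] -/
theorem clayA_regularity_of_steps {lam : ℝ} {χ : ℝ → ℝ} (hlam : 0 < lam) (hχ : IsCutoff χ)
    (hbridge : ∀ ν : ℝ, 0 < ν → ClayBridge_SuitableLerayHopf ν)
    (h29 : ∀ ν : ℝ, 0 < ν → Step29_AlmostMono ν lam χ) (h37 : ∀ ν : ℝ, 0 < ν → Step37_PersistentValue ν lam χ)
    (h41x : ∀ ν : ℝ, 0 < ν → Step41_ExactInequality ν lam χ) (h42 : ∀ ν : ℝ, 0 < ν → Step42_Vanishing ν lam χ)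
    (h41 : ∀ ν : ℝ, 0 < ν → StepL41_Rigidity ν χ) (h44 : ∀ ν : ℝ, 0 < ν → Step44_Contradiction ν lam χ)
    (h45 : ∀ ν : ℝ, 0 < ν → Step45_NonnegLimit_implicit ν lam χ)
    (h53 : ∀ ν : ℝ, 0 < ν → Step53_Reduction ν lam χ) : ClayVariants.clayR3.Regularity := fun ν hν =>
  clayA_of_claimed hν hlam hχ (hbridge ν hν)
    (claim_of_steps (h29 ν hν) (h37 ν hν) (h41x ν hν) (h42 ν hν) (h41 ν hν) (h44 ν hν) (h45 ν hν)) (h53 ν hν)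

/-! ## Rev 2 (2026-08-27, after the 2-READ of typist-11 g7 F-i/F-ii and refuter-1 g5's KILL-TYPE; ADDITIVE — one import line
added at l.4 (for the CLAY-LINK keeper block of lit-4 g9 appended at the end), so rev-1 l.4–731 are now l.5–732, BYTE-IDENTICAL
(every rev-1 declaration, formerly l.114–727, now l.115–728, +1); only the closing `end`s and the trailer moved down)

**F-i — CARRIER ARTEFACT DECLARED BY THE TYPIST.** The rev-1 square term `Dfun` (l.247) is a real BOCHNER integral, hence
junk `0` on a non-integrable integrand; and the printed integrand `|∇u − u ⊗ ∇log Φ_{ρ,z0}|² Φ_{ρ,z0}` is NOT integrable at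
the (unshifted) vertex whenever `u(z0) ≠ 0`: with `∇ log G_{z0} = −(x − x0)/(2ν(t0 − t))` one has `∫ |x − x0|² G_{z0} dx /
(4ν²(t0 − t)²) = 3/(2ν(t0 − t))`, log-divergent in `t ↑ t0` (2-READ typist-11 g7 15:05:19Z; refuter-1 g5 15:05:47Z;
re-derived by the typist). So on the constant ancient flow `u* ≡ a ≠ 0` the PRINTED `D*(R; 0)` is `+∞` (Lemma 4.1's
hypothesis «D*(R; 0) = 0» is not met in print) while the rev-1 `Dfun` returns `0` — the rev-1 faces that read `Dfun`
(`Step29_AlmostMono` l.313 square-term part, `Step33_ScaleInvariance` l.345 second conjunct, `Step41_ExactInequality`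
l.461, `IsRigidLimit` l.426, `Step42_Vanishing` l.486, `StepL41_Rigidity` l.494) are ARTEFACT-PRONE and are SUPERSEDED FOR
ADJUDICATION by the `…E` faces below, whose square term `DfunE` is the extended (`ℝ≥0∞`) Lebesgue integral: an infinite
square term now makes the printed almost-monotonicity inequality FAIL where the print's own objects make it fail (§2.9),
and makes «D*(R; 0) = 0» carry integrability (Lemma 4.1 misses the constant flow, as in print). Nothing else changes:
`I` and its four terms keep the real carrier (their integrands are integrable on smooth bounded fields — only `|∇ log
G|² G ∼ |x − x0|² G/(t0 − t)²` diverges).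

**F-ii — the §3.3 lettering option.** §3.3 p.8 l.1–5 is consumed in print (§3.7 l.18–20, §4.1 l.49–50) but in rev 1 only
through the docstrings of 37/41. Rev 2 adds the paper's §3.6–§3.7 and §4.1 reasoning as NAMED IMPLICATIONS
(`Step37_Bookkeeping`, `Step41_Bookkeeping`) and the fine composition `claim_of_steps_fine` whose binders run in print
order 29E → 32 → 33E → 34 → 35 → L31 → book37 → book41 → 42E → L41E → 44 → 45impl; the coarse `claim_of_stepsE` (29E, 37,
41E, 42E, L41E, 44, 45impl) is kept. Which composition letters is the chair's call. -/

/-- **The dissipation square term, honest carrier** `D(ρ; z0) = ∫∫_{Q_ρ(z0)} |∇u − u ⊗ ∇ log Φ_{ρ,z0}|² Φ_{ρ,z0} ∈ [0, ∞]`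
(§2.9 p.6 l.38–44; §4.1 p.10 l.19–26), as an extended Lebesgue integral (rev 2, F-i).
[cite: Taghizadeh2026, §2.9 p.6 l.38–44; §4.1 p.10 l.19–26] -/
def DfunE (ν : ℝ) (χ : ℝ → ℝ) (ρ : ℝ) (z0 : ℝ × E3) (u : ℝ → E3 → E3) (G : ℝ → E3 → E3 →L[ℝ] E3) : ℝ≥0∞ :=
  ∫⁻ z in parabolicCylinder ρ z0, ENNReal.ofReal
    (frobeniusNormSq (G z.1 z.2 - tensor (u z.1 z.2) (gradLogPhi ν χ ρ z0 z.1 z.2)) * Phi ν χ ρ z0 z.1 z.2)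

/-- The weighted scale integral `∫_{r₁}^{r₂} ρ⁻¹ D(ρ; z0) dρ ∈ [0, ∞]` of the integrated almost-monotonicity / exact
inequality (§3.1 p.7 l.34–38 «integrate in ρ»; §4.1 p.9 l.52 – p.10 l.18). [cite: Taghizadeh2026, §4.1 p.9 l.52 – p.10 l.18] -/
def sqTermE (ν : ℝ) (χ : ℝ → ℝ) (r₁ r₂ : ℝ) (z0 : ℝ × E3) (u : ℝ → E3 → E3) (G : ℝ → E3 → E3 →L[ℝ] E3) : ℝ≥0∞ :=
  ∫⁻ ρ in Ioo r₁ r₂, ENNReal.ofReal ρ⁻¹ * DfunE ν χ ρ z0 u G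

/-- **§2.9 p.6 l.36–56 «Almost-Monotonicity» (IMPORTED: companion (63)/(64) p.16 l.46–65), honest carrier (rev 2, F-i)**:
as `Step29_AlmostMono` l.313 but with the square term in `[0, ∞]`: the integrated inequality reads `ofReal c ·
∫_{r₁}^{r₂} ρ⁻¹ D ≤ ofReal (I(r₂; z0) − I(r₁; z0) + C ∫_{r₁}^{r₂} ρ^α dρ)`, so an infinite square term makes it FAIL (as
the printed `d/dr I ≥ c r⁻¹ D − C r^α` fails when `D = +∞` and `I` is finite), instead of vanishing; plus the existence
of the limit `I0(z0)`. Constants `c, C, α, r*` after the solution and the point, as in rev 1.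
[claim: Taghizadeh2026, status: disputed] [cite: TaghizadehReduction2026, (63)–(64) p.16 l.46–65] -/
def Step29E_AlmostMono (ν lam : ℝ) (χ : ℝ → ℝ) : Prop :=
  0 < ν → 0 < lam → IsCutoff χ → ∀ (T : ℝ) (u : ℝ → E3 → E3) (p : ℝ → E3 → ℝ) (G : ℝ → E3 → E3 →L[ℝ] E3),
    IsSolution ν T u p G → ∀ z0 : ℝ × E3, z0 ∈ (slab T : Set (ℝ × E3)) →
      ∃ c C α rs : ℝ, 0 < c ∧ 0 < C ∧ 0 < α ∧ 0 < rs ∧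
        (∀ r₁ r₂ : ℝ, 0 < r₁ → r₁ < r₂ → r₂ < rs →
          ENNReal.ofReal c * sqTermE ν χ r₁ r₂ z0 u G ≤
            ENNReal.ofReal (Ifun ν lam χ r₂ z0 u p G - Ifun ν lam χ r₁ z0 u p G + C * ∫ ρ in r₁..r₂, ρ ^ α)) ∧
        ∃ L : ℝ, Tendsto (fun r => Ifun ν lam χ r z0 u p G) (𝓝[>] 0) (𝓝 L)

/-- **§3.3 p.8 l.1–5 scale invariance, honest carrier for the `D` clause (rev 2)**: `I^{(r)}(R; 0) = I(rR; z0)` (real,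
unchanged) and `D^{(r)}(R; 0) = D(rR; z0)` in `[0, ∞]`. The rev-1 BOOKKEEPING NOTE (l.345 docstring) stands: under the
NS change of variables the typed `E1`, `E^fluc_0` pick up `r³` and `C`, `C_harm`, `D` pick up `r²`.
[claim: Taghizadeh2026, status: disputed] -/
def Step33E_ScaleInvariance (ν lam : ℝ) (χ : ℝ → ℝ) : Prop :=
  0 < ν → 0 < lam → IsCutoff χ → ∀ (T : ℝ) (u : ℝ → E3 → E3) (p : ℝ → E3 → ℝ) (G : ℝ → E3 → E3 →L[ℝ] E3),
    IsSolution ν T u p G → ∀ z0 : ℝ × E3, z0 ∈ (slab T : Set (ℝ × E3)) → ∀ r : ℝ, 0 < r →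
      ∀ R : ℝ, 0 < R → (r * R) ^ 2 ≤ z0.1 →
        Ifun ν lam χ R orig (rescaleU z0 r u) (rescaleP z0 r p) (rescaleG z0 r G) = Ifun ν lam χ (r * R) z0 u p G ∧
        DfunE ν χ R orig (rescaleU z0 r u) (rescaleG z0 r G) = DfunE ν χ (r * R) z0 u G

/-- **§4.1 exact inequality, honest carrier (rev 2)**: as `Step41_ExactInequality` l.461 with `ofReal c · ∫_{R₁}^{R₂} ρ⁻¹ D*
≤ ofReal (I*(R₂; 0) − I*(R₁; 0))` in `[0, ∞]`. [claim: Taghizadeh2026, status: disputed] -/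
def Step41E_ExactInequality (ν lam : ℝ) (χ : ℝ → ℝ) : Prop :=
  0 < ν → 0 < lam → IsCutoff χ → ∀ (T : ℝ) (u : ℝ → E3 → E3) (p : ℝ → E3 → ℝ) (G : ℝ → E3 → E3 →L[ℝ] E3)
    (z0 : ℝ × E3) (ε0 : ℝ), HasPositiveLimit ν lam χ T u p G z0 ε0 →
      ∀ rk : ℕ → ℝ, (∀ k, 0 < rk k) → Tendsto rk atTop (𝓝 0) →
        ∀ (us : ℝ → E3 → E3) (ps : ℝ → E3 → ℝ) (Gs : ℝ → E3 → E3 →L[ℝ] E3), IsAncient ν us ps Gs →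
          ConvergesTo (fun k => rescaleU z0 (rk k) u) (fun k => rescaleP z0 (rk k) p)
            (fun k => rescaleG z0 (rk k) G) us ps Gs →
            ∃ c : ℝ, 0 < c ∧ ∀ R₁ R₂ : ℝ, 0 < R₁ → R₁ < R₂ →
              ENNReal.ofReal c * sqTermE ν χ R₁ R₂ orig us Gs ≤
                ENNReal.ofReal (Ifun ν lam χ R₂ orig us ps Gs - Ifun ν lam χ R₁ orig us ps Gs)

/-- **The rigid blow-up limit of §3.8 / §4.1, honest carrier (rev 2)**: ancient, `I*(R; 0) = ε0` for all `R > 0`, and the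
exact inequality in `[0, ∞]`. [cite: Taghizadeh2026, §3.7–§3.8 p.9 l.14–35; §4.1 p.10 l.7–26] -/
def IsRigidLimitE (ν lam : ℝ) (χ : ℝ → ℝ) (us : ℝ → E3 → E3) (ps : ℝ → E3 → ℝ)
    (Gs : ℝ → E3 → E3 →L[ℝ] E3) (ε0 : ℝ) : Prop :=
  IsAncient ν us ps Gs ∧ (∀ R : ℝ, 0 < R → Ifun ν lam χ R orig us ps Gs = ε0) ∧
    ∃ c : ℝ, 0 < c ∧ ∀ R₁ R₂ : ℝ, 0 < R₁ → R₁ < R₂ →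
      ENNReal.ofReal c * sqTermE ν χ R₁ R₂ orig us Gs ≤
        ENNReal.ofReal (Ifun ν lam χ R₂ orig us ps Gs - Ifun ν lam χ R₁ orig us ps Gs)

/-- **§3.8 package, honest carrier (rev 2).** [claim: Taghizadeh2026, status: disputed] -/
def Step3_PackageE (ν lam : ℝ) (χ : ℝ → ℝ) : Prop :=
  0 < ν → 0 < lam → IsCutoff χ → ∀ (T : ℝ) (u : ℝ → E3 → E3) (p : ℝ → E3 → ℝ) (G : ℝ → E3 → E3 →L[ℝ] E3)
    (z0 : ℝ × E3) (ε0 : ℝ), HasPositiveLimit ν lam χ T u p G z0 ε0 →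
      ∃ (us : ℝ → E3 → E3) (ps : ℝ → E3 → ℝ) (Gs : ℝ → E3 → E3 →L[ℝ] E3), IsRigidLimitE ν lam χ us ps Gs ε0

/-- **§4.2 p.10 l.27–53 «Vanishing of the Dissipation Square Term», honest carrier (rev 2)**: a rigid limit has `D*(ρ; 0)
= 0` for a.e. `ρ > 0` (now including: the square-term integrand is integrable there). TRUE-type (`ofReal` of `0` bounds
a nonnegative extended integral). [cite: Taghizadeh2026, §4.2 p.10 l.27–53] -/
def Step42E_Vanishing (ν lam : ℝ) (χ : ℝ → ℝ) : Prop :=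
  0 < ν → 0 < lam → IsCutoff χ → ∀ (us : ℝ → E3 → E3) (ps : ℝ → E3 → ℝ) (Gs : ℝ → E3 → E3 →L[ℝ] E3) (ε0 : ℝ),
    IsRigidLimitE ν lam χ us ps Gs ε0 → ∀ᵐ ρ ∂(volume.restrict (Ioi (0 : ℝ))), DfunE ν χ ρ orig us Gs = 0

/-- **Lemma 4.1 p.10 l.71 – p.11 l.36 «Rigidity on an interior cylinder», honest carrier (rev 2)**: «Fix R > 0 such
that D*(R; 0) = 0. Then u* = 0 a.e. on Q_{R/2}(0)» with `D* ∈ [0, ∞]` — the hypothesis now says the square-term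
integrand is integrable AND integrates to zero, i.e. `∇u* = u* ⊗ ∇ log Φ_{R,0}` a.e. where `Φ_{R,0} > 0` (display (2)
p.10 l.84–88); the constant flow `u* ≡ a ≠ 0` has `D*(R; 0) = +∞` and is not a countermodel (it was one only for the
rev-1 junk-0 face l.494 — F-i). TRUE-type reading. [cite: Taghizadeh2026, Lemma 4.1 p.10 l.71 – p.11 l.36] -/
def StepL41E_Rigidity (ν : ℝ) (χ : ℝ → ℝ) : Prop :=
  0 < ν → IsCutoff χ → ∀ (us : ℝ → E3 → E3) (ps : ℝ → E3 → ℝ) (Gs : ℝ → E3 → E3 →L[ℝ] E3),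
    IsAncient ν us ps Gs → ∀ R : ℝ, 0 < R → DfunE ν χ R orig us Gs = 0 →
      ∀ᵐ z ∂(volume.restrict (parabolicCylinder (R / 2) orig)), us z.1 z.2 = 0

/-- **§3.6–§3.7's own reasoning as a named implication (rev 2, F-ii)**: FROM §3.2 (rescaled pairs are solutions), §3.3
(scale invariance), §3.4 (uniform bounds), §3.5 (compactness), Lemma 3.1 (stability) and §2.9 (limit exists; Lemma 2.1
continuity) TO the persistent value `I*(R; 0) = ε0` (§3.7 p.9 l.14–31: refinement over `R ∈ Q₊`, «By scale invariance»,
«Passing to the limit», continuity). The bookkeeping is the paper's; typed so that its printed inputs are BINDERS of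
`claim_of_steps_fine`. [claim: Taghizadeh2026, status: disputed] -/
def Step37_Bookkeeping (ν lam : ℝ) (χ : ℝ → ℝ) : Prop :=
  Step32_Rescale ν → Step33E_ScaleInvariance ν lam χ → Step34_Bounds ν lam χ → Step35_Compactness ν lam χ →
    StepL31_Stability ν lam χ → Step29E_AlmostMono ν lam χ → Step37_PersistentValue ν lam χ

/-- **§4.1's own reasoning as a named implication (rev 2, F-ii)**: «Apply the almost-monotonicity inequality … at scales
r = r_kρ …, integrate in ρ, and use scale invariance … Passing k → ∞ and using Lemma 3.1 together with lower
semicontinuity of D^{(k)}(ρ; 0) gives the exact inequality» (p.9 l.49 – p.10 l.18): FROM §2.9, §3.3, Lemma 3.1 TO the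
exact inequality. [claim: Taghizadeh2026, status: disputed] -/
def Step41_Bookkeeping (ν lam : ℝ) (χ : ℝ → ℝ) : Prop :=
  Step29E_AlmostMono ν lam χ → Step33E_ScaleInvariance ν lam χ → StepL31_Stability ν lam χ →
    Step41E_ExactInequality ν lam χ

/-! ### Rev-2 compositions (PROVED) -/

/-- §3.8 from §3.7 and §4.1, honest carrier. [cite: Taghizadeh2026, §3.8 p.9 l.32–35; §4.1 p.10 l.7–26] -/
theorem package_of_stepsE {ν lam : ℝ} {χ : ℝ → ℝ} (h37 : Step37_PersistentValue ν lam χ)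
    (h41 : Step41E_ExactInequality ν lam χ) : Step3_PackageE ν lam χ := by
  intro hν hlam hχ T u p G z0 ε0 hpl
  obtain ⟨rk, hrk, hrk0, us, ps, Gs, hanc, hconv, hconst⟩ := h37 hν hlam hχ T u p G z0 ε0 hpl
  obtain ⟨c, hc, hineq⟩ := h41 hν hlam hχ T u p G z0 ε0 hpl rk hrk hrk0 us ps Gs hanc hconv
  exact ⟨us, ps, Gs, hanc, hconst, c, hc, hineq⟩

/-- §4.2–§4.4 close the contradiction on a rigid limit, honest carrier: `ε0 = 0`.
[cite: Taghizadeh2026, §4.2–§4.4 p.10–11] -/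
theorem eps_eq_zero_of_rigidE {ν lam : ℝ} {χ : ℝ → ℝ} (hν : 0 < ν) (hlam : 0 < lam) (hχ : IsCutoff χ)
    (h42 : Step42E_Vanishing ν lam χ) (h41 : StepL41E_Rigidity ν χ) (h44 : Step44_Contradiction ν lam χ)
    {us : ℝ → E3 → E3} {ps : ℝ → E3 → ℝ} {Gs : ℝ → E3 → E3 →L[ℝ] E3} {ε0 : ℝ}
    (hrig : IsRigidLimitE ν lam χ us ps Gs ε0) : ε0 = 0 := by
  have hanc : IsAncient ν us ps Gs := hrig.1
  have hconst := hrig.2.1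
  have hD : ∀ᵐ ρ ∂(volume.restrict (Ioi (0 : ℝ))), DfunE ν χ ρ orig us Gs = 0 :=
    h42 hν hlam hχ us ps Gs ε0 hrig
  have hvan : ∀ R : ℝ, 0 < R → ∀ᵐ z ∂(volume.restrict (parabolicCylinder (R / 2) orig)), us z.1 z.2 = 0 := by
    intro R hR
    have hpos : 0 < volume (Icc R (R + 1) : Set ℝ) := by
      rw [Real.volume_Icc]; simp
    have hsub : (Icc R (R + 1) : Set ℝ) ⊆ Ioi 0 := fun ρ hρ => lt_of_lt_of_le hR hρ.1
    have hD' : ∀ᵐ ρ ∂(volume.restrict (Icc R (R + 1))), DfunE ν χ ρ orig us Gs = 0 :=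
      ae_restrict_of_ae_restrict_of_subset hsub hD
    obtain ⟨R', hR'mem, hR'D⟩ : ∃ R' ∈ Icc R (R + 1), DfunE ν χ R' orig us Gs = 0 := by
      by_contra hcon
      push Not at hcon
      have : ∀ᵐ ρ ∂(volume.restrict (Icc R (R + 1))), False := by
        filter_upwards [hD', ae_restrict_mem measurableSet_Icc] with ρ h1 h2 using hcon ρ h2 h1
      rw [ae_iff] at this
      simp only [not_false_eq_true, setOf_true, Measure.restrict_apply_univ] at this
      exact absurd this hpos.ne'
    have hR'pos : 0 < R' := lt_of_lt_of_le hR hR'mem.1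
    have hv := h41 hν hχ us ps Gs hanc R' hR'pos hR'D
    have hsubQ : parabolicCylinder (R / 2) orig ⊆ parabolicCylinder (R' / 2) orig := by
      intro z hz
      simp only [parabolicCylinder, orig, mem_prod, mem_Ioo, mem_ball] at hz ⊢
      refine ⟨⟨?_, hz.1.2⟩, lt_of_lt_of_le hz.2 (by linarith [hR'mem.1])⟩
      have : (R / 2) ^ 2 ≤ (R' / 2) ^ 2 := by
        apply pow_le_pow_left₀ (by linarith) (by linarith [hR'mem.1])
      linarith [hz.1.1]
    exact ae_restrict_of_ae_restrict_of_subset hsubQ hv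
  have h0 : Ifun ν lam χ 1 orig us ps Gs = 0 := h44 hν hlam hχ us ps Gs hanc hvan
  have h1 : Ifun ν lam χ 1 orig us ps Gs = ε0 := hconst 1 one_pos
  linarith

/-- **THEOREM 1.1 from the printed chain via the §3.8 package, honest carrier (rev 2).**
[cite: Taghizadeh2026, §4.5 p.11 l.55–61; §5.1–5.2 p.12 l.8–39] -/
theorem claim_of_packageE {ν lam : ℝ} {χ : ℝ → ℝ}
    (h29 : Step29E_AlmostMono ν lam χ) (h3 : Step3_PackageE ν lam χ) (h42 : Step42E_Vanishing ν lam χ)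
    (h41 : StepL41E_Rigidity ν χ) (h44 : Step44_Contradiction ν lam χ)
    (h45 : Step45_NonnegLimit_implicit ν lam χ) : ClaimedTheorem ν lam χ := by
  intro hν hlam hχ T u p G hsol z0 hz0
  obtain ⟨c, C, α, rs, -, -, -, -, -, L, hL⟩ := h29 hν hlam hχ T u p G hsol z0 hz0
  have hL0 : 0 ≤ L := h45 hν hlam hχ T u p G hsol z0 hz0 L hL
  rcases hL0.eq_or_lt with h | hpos
  · subst h; exact hL
  · exfalso
    obtain ⟨us, ps, Gs, hrig⟩ := h3 hν hlam hχ T u p G z0 L ⟨hsol, hz0, hpos, hL⟩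
    have := eps_eq_zero_of_rigidE hν hlam hχ h42 h41 h44 hrig
    linarith

/-- **THEOREM 1.1 — coarse composition on the honest-carrier binders (rev 2): 29E, 37, 41E, 42E, L41E, 44, 45impl.**
COMPOSES. [cite: Taghizadeh2026, §4.5 p.11 l.55–61; §5.1–5.2 p.12 l.8–39] -/
theorem claim_of_stepsE {ν lam : ℝ} {χ : ℝ → ℝ}
    (h29 : Step29E_AlmostMono ν lam χ) (h37 : Step37_PersistentValue ν lam χ)
    (h41x : Step41E_ExactInequality ν lam χ) (h42 : Step42E_Vanishing ν lam χ)
    (h41 : StepL41E_Rigidity ν χ) (h44 : Step44_Contradiction ν lam χ)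
    (h45 : Step45_NonnegLimit_implicit ν lam χ) : ClaimedTheorem ν lam χ :=
  claim_of_packageE h29 (package_of_stepsE h37 h41x) h42 h41 h44 h45

/-- **THEOREM 1.1 — FINE composition (rev 2, F-ii), binders in print order: 29E (§2.9) → 32 (§3.2) → 33E (§3.3) → 34
(§3.4) → 35 (§3.5) → L31 (Lemma 3.1) → book37 (§3.6–3.7) → book41 (§4.1) → 42E (§4.2) → L41E (Lemma 4.1) → 44 (§4.4) →
45impl (§4.5).** COMPOSES. [cite: Taghizadeh2026, §3–§4 p.7–11; §4.5 p.11 l.55–61] -/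
theorem claim_of_steps_fine {ν lam : ℝ} {χ : ℝ → ℝ}
    (h29 : Step29E_AlmostMono ν lam χ) (h32 : Step32_Rescale ν) (h33 : Step33E_ScaleInvariance ν lam χ)
    (h34 : Step34_Bounds ν lam χ) (h35 : Step35_Compactness ν lam χ) (hL31 : StepL31_Stability ν lam χ)
    (hb37 : Step37_Bookkeeping ν lam χ) (hb41 : Step41_Bookkeeping ν lam χ) (h42 : Step42E_Vanishing ν lam χ)
    (hL41 : StepL41E_Rigidity ν χ) (h44 : Step44_Contradiction ν lam χ)
    (h45 : Step45_NonnegLimit_implicit ν lam χ) : ClaimedTheorem ν lam χ :=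
  claim_of_stepsE h29 (hb37 h32 h33 h34 h35 hL31 h29) (hb41 h29 h33 hL31) h42 hL41 h44 h45

/-- **THEOREM 1.1 — the REF's F-ii shape (ref-1 g6 15:10:50Z; CHAIR 15:12Z (2)(b)): binders in print order 29E → 33E →
37 → 41x → 42E → L41E → 44 → 45impl, with §3.3 CONSUMED** — the §3.6–§3.7 and §4.1 binders are taken FROM §3.3 (and
§2.9), as the print invokes them («By scale invariance …», p.9 l.18–20; «use scale invariance», p.10 l.49–50).
COMPOSES. [cite: Taghizadeh2026, §3.3 p.8 l.1–5; §3.7 p.9 l.18–20; §4.1 p.9 l.49 – p.10 l.18; §4.5 p.11 l.55–61] -/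
theorem claim_of_stepsE' {ν lam : ℝ} {χ : ℝ → ℝ}
    (h29 : Step29E_AlmostMono ν lam χ) (h33 : Step33E_ScaleInvariance ν lam χ)
    (h37 : Step33E_ScaleInvariance ν lam χ → Step37_PersistentValue ν lam χ)
    (h41x : Step29E_AlmostMono ν lam χ → Step33E_ScaleInvariance ν lam χ → Step41E_ExactInequality ν lam χ)
    (h42 : Step42E_Vanishing ν lam χ) (hL41 : StepL41E_Rigidity ν χ) (h44 : Step44_Contradiction ν lam χ)
    (h45 : Step45_NonnegLimit_implicit ν lam χ) : ClaimedTheorem ν lam χ :=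
  claim_of_stepsE h29 (h37 h33) (h41x h29 h33) h42 hL41 h44 h45

/-- The corollary from the fine chain + §5.3 + §5.4 (rev 2). [cite: Taghizadeh2026, §5.3–§5.4 p.12 l.40 – p.13 l.3] -/
theorem corollary_of_steps_fine {ν lam : ℝ} {χ : ℝ → ℝ}
    (h29 : Step29E_AlmostMono ν lam χ) (h32 : Step32_Rescale ν) (h33 : Step33E_ScaleInvariance ν lam χ)
    (h34 : Step34_Bounds ν lam χ) (h35 : Step35_Compactness ν lam χ) (hL31 : StepL31_Stability ν lam χ)
    (hb37 : Step37_Bookkeeping ν lam χ) (hb41 : Step41_Bookkeeping ν lam χ) (h42 : Step42E_Vanishing ν lam χ)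
    (hL41 : StepL41E_Rigidity ν χ) (h44 : Step44_Contradiction ν lam χ)
    (h45 : Step45_NonnegLimit_implicit ν lam χ) (h53 : Step53_Reduction ν lam χ) (h54 : Step54_Smooth ν) :
    ClaimedCorollary ν lam χ :=
  corollary_of_steps (claim_of_steps_fine h29 h32 h33 h34 h35 hL31 hb37 hb41 h42 hL41 h44 h45) h53 h54

/-- Without the implicit binder, the honest-carrier chain too gives only `I0(z0) ≤ 0`.
[cite: Taghizadeh2026, §4.5 p.11 l.55–58] -/
theorem limit_nonpos_of_stepsE {ν lam : ℝ} {χ : ℝ → ℝ}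
    (h3 : Step3_PackageE ν lam χ) (h42 : Step42E_Vanishing ν lam χ)
    (h41 : StepL41E_Rigidity ν χ) (h44 : Step44_Contradiction ν lam χ)
    (hν : 0 < ν) (hlam : 0 < lam) (hχ : IsCutoff χ) {T : ℝ} {u : ℝ → E3 → E3} {p : ℝ → E3 → ℝ}
    {G : ℝ → E3 → E3 →L[ℝ] E3} (hsol : IsSolution ν T u p G) {z0 : ℝ × E3} (hz0 : z0 ∈ (slab T : Set (ℝ × E3)))
    {L : ℝ} (hL : Tendsto (fun r => Ifun ν lam χ r z0 u p G) (𝓝[>] 0) (𝓝 L)) : L ≤ 0 := by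
  by_contra hpos
  push Not at hpos
  obtain ⟨us, ps, Gs, hrig⟩ := h3 hν hlam hχ T u p G z0 L ⟨hsol, hz0, hpos, hL⟩
  have := eps_eq_zero_of_rigidE hν hlam hχ h42 h41 h44 hrig
  linarith


/-! ### Clay bridge DISCHARGED — CLAY-LINK keeper `ns-claims-lit-4` g9 (ADDITIVE; nothing above is touched)

The module docstring's «CKN 1982 Appendix, not in the tree in this vocabulary» is superseded: the tree PROVES that
Leray's weak solutions are suitable — `Literature.Analysis.FluidPDE.exists_isGlobalLerayHopf_and_isLocalEnergySolutionOn`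
(`LeraySuitableWeakSolutions.lean`; Caffarelli–Kohn–Nirenberg 1982, Appendix; Seregin 2014, App. B Def. B.1):
for `ν > 0` and every weakly divergence-free `u₀ ∈ L²(ℝ³)` there is a global Leray–Hopf weak solution `v` with the
Riesz-transform pressure `p` such that `(v, p)` is a local energy solution — in particular CKN-suitable — on every
strip `(0,T) × ℝ³`. Its Leray–Hopf weak gradient is a space–time weak gradient on the strip with finite dissipation
(`IsLerayHopfOn.exists_hasWeakSpatialGradientOn`) and `v ∈ L^∞_t L²_x` is the Leray–Hopf energy bound, i.e. exactly
the §2.1 class `IsSolution ν T v p G`. So `ClayBridge_SuitableLerayHopf ν` HOLDS for every `ν > 0` and the Clay link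
`clayA_of_claimed` is free of the bridge; the §5.3–§5.4 corollary face reaches (A) with no binder at all. -/

/-- **The Clay bridge holds** (Δ5 discharged): every Clay datum — smooth, divergence free, class (4) — launches a
global Leray–Hopf weak solution lying in the §2.1 class on every slab `(0, T)`: Leray's weak solutions are local
energy solutions (CKN 1982, Appendix, PROVED in the tree), the Leray–Hopf weak gradient is a space–time weak gradient
with finite dissipation, and the energy is essentially bounded in time.
[cite: CaffarelliKohnNirenberg1982, Appendix (existence of suitable weak solutions)] [cite: Leray1934, Ch. V §31, p. 241]
[cite: Seregin2014, App. B Def. B.1] -/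
theorem clayBridge_holds {ν : ℝ} (hν : 0 < ν) : ClayBridge_SuitableLerayHopf ν := by
  intro u₀ hu₀ hdiv hdec
  -- the datum is `L²` and weakly divergence free (as in `clay_solution_of_locallyBounded_globalLerayHopf`)
  have hL2 : ∫⁻ x, ‖u₀ x‖ₑ ^ 2 < ⊤ := by
    refine lt_of_le_of_lt (le_of_eq (lintegral_congr fun x => ?_))
      (hdec.lintegral_enorm_iteratedFDeriv_sq_lt_top 0)
    rw [← ofReal_norm, ← ofReal_norm, norm_iteratedFDeriv_zero]
  have hu2 : MemLp u₀ 2 volume :=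
    ⟨hu₀.continuous.aestronglyMeasurable, eLpNorm_two_lt_top_of_lintegral_enorm_sq_lt_top hL2⟩
  have hwdiv : IsWeaklyDivFree u₀ :=
    VectorCalculus.IsDivFree.isWeaklyDivFree_holds (fun x => hdiv x) (hu₀.of_le (mod_cast le_top))
  -- Leray's weak solution with its Riesz-transform pressure: global Leray–Hopf and a local energy solution on
  -- every strip (CKN 1982, Appendix)
  obtain ⟨v, p, hLH, -, -, -, -, -, hLE⟩ := exists_isGlobalLerayHopf_and_isLocalEnergySolutionOn hν hu2 hwdiv
  refine ⟨v, hLH, fun T hT => ?_⟩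
  -- the Leray–Hopf weak gradient as a space–time weak gradient on the strip, with finite dissipation
  obtain ⟨G, hG, -, hGint, -⟩ := (hLH T hT).exists_hasWeakSpatialGradientOn
  -- `v ∈ L^∞(0,T; L²)`
  obtain ⟨C, hC⟩ := (hLH T hT).energy_bound
  exact ⟨p, G,
    { suitable := (hLE T hT).suitable
      grad := hG
      energy := ⟨C, hC⟩
      dissipation := hGint }⟩

/-- **Fefferman (A) at viscosity `ν` from Theorem 1.1 + §5.3 — the bridge DISCHARGED** (`clayA_of_claimed` fed with
`clayBridge_holds`): modulo nothing but the paper's own imported reduction principle `Step53_Reduction`.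
[cite: FeffermanClay2006, (A) with (4) (6) (7) p. 2] [cite: Taghizadeh2026, §5.3–§5.4 p.12 l.40 – p.13 l.15] -/
theorem clayA_of_claimed' {ν lam : ℝ} {χ : ℝ → ℝ} (hν : 0 < ν) (hlam : 0 < lam) (hχ : IsCutoff χ)
    (hthm : ClaimedTheorem ν lam χ) (h53 : Step53_Reduction ν lam χ) : ClayVariants.clayR3.RegularityAt ν :=
  clayA_of_claimed hν hlam hχ (clayBridge_holds hν) hthm h53

/-- **Fefferman (A) (all viscosities) from the whole printed chain — NO bridge hypothesis.**
[cite: FeffermanClay2006, (A) p. 2] [cite: Taghizadeh2026, Thm 1.1 p.2 l.31–41; §5.3–§5.4] -/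
theorem clayA_regularity_of_steps' {lam : ℝ} {χ : ℝ → ℝ} (hlam : 0 < lam) (hχ : IsCutoff χ)
    (h29 : ∀ ν : ℝ, 0 < ν → Step29_AlmostMono ν lam χ) (h37 : ∀ ν : ℝ, 0 < ν → Step37_PersistentValue ν lam χ)
    (h41x : ∀ ν : ℝ, 0 < ν → Step41_ExactInequality ν lam χ) (h42 : ∀ ν : ℝ, 0 < ν → Step42_Vanishing ν lam χ)
    (h41 : ∀ ν : ℝ, 0 < ν → StepL41_Rigidity ν χ) (h44 : ∀ ν : ℝ, 0 < ν → Step44_Contradiction ν lam χ)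
    (h45 : ∀ ν : ℝ, 0 < ν → Step45_NonnegLimit_implicit ν lam χ)
    (h53 : ∀ ν : ℝ, 0 < ν → Step53_Reduction ν lam χ) : ClayVariants.clayR3.Regularity :=
  clayA_regularity_of_steps hlam hχ (fun _ hν => clayBridge_holds hν) h29 h37 h41x h42 h41 h44 h45 h53

/-- **Fefferman (A) at viscosity `ν` from the §5.3–§5.4 COROLLARY ALONE — no step binder, no bridge**: the printed
sentence «suitable weak solutions are smooth on R³ × (0, T]» (`ClaimedCorollary`, typed on the open slab) applied to
the suitable Leray–Hopf solution of `clayBridge_holds` on the slab `(0, T+1)` makes it essentially bounded on the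
parabolic cylinder `Q_r(T, x)`, `r² < T`, below every point `(T, x)`, `T > 0` (a jointly smooth version is bounded on
the compact closure `[T − r², T] × B̄_r(x) ⊂ (0, T+1) × ℝ³`); the tree door
`clay_solution_of_locallyBounded_globalLerayHopf` supplies the Clay solution on `[0, ∞)` with (6)–(7).
[cite: FeffermanClay2006, (A) with (4) (6) (7) p. 2] [cite: Taghizadeh2026, §5.4 p.13 l.1–15] -/
theorem clayA_of_corollary {ν lam : ℝ} {χ : ℝ → ℝ} (hν : 0 < ν) (hlam : 0 < lam) (hχ : IsCutoff χ)
    (hcor : ClaimedCorollary ν lam χ) : ClayVariants.clayR3.RegularityAt ν := by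
  intro u₀ hu₀ hdiv hdec
  obtain ⟨v, hv, hsuit⟩ := clayBridge_holds hν u₀ hu₀ hdiv hdec
  have hbd : ∀ T : ℝ, 0 < T → ∀ x : E3, ∃ r : ℝ, 0 < r ∧
      eLpNorm (uncurry v) ⊤ (volume.restrict (parabolicCylinder r ((T : ℝ), x))) < ⊤ := by
    intro T hT x
    obtain ⟨p, G, hsol⟩ := hsuit (T + 1) (by linarith)
    obtain ⟨w, hwv, hw⟩ := hcor hν hlam hχ (T + 1) v p G hsol
    -- a radius with `r² < T`, so that the closed cylinder stays inside the open slab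
    obtain ⟨r, hr, hrT⟩ : ∃ r : ℝ, 0 < r ∧ r ^ 2 < T := by
      refine ⟨min 1 (T / 2) / 1, by positivity, ?_⟩
      have h1 : min 1 (T / 2) ≤ 1 := min_le_left _ _
      have h2 : min 1 (T / 2) ≤ T / 2 := min_le_right _ _
      have h3 : 0 < min 1 (T / 2) := by positivity
      nlinarith
    refine ⟨r, hr, ?_⟩
    -- the compact closure `K = [T − r², T] × B̄_r(x)` of the cylinder, inside `(0, T+1) × ℝ³`
    set K : Set (ℝ × E3) := Icc (T - r ^ 2) T ×ˢ closedBall x r with hK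
    have hKc : IsCompact K := isCompact_Icc.prod (isCompact_closedBall _ _)
    have hKsub : K ⊆ Ioo 0 (T + 1) ×ˢ (univ : Set E3) := by
      rintro ⟨t, y⟩ ⟨ht, -⟩
      exact ⟨⟨by linarith [ht.1], by linarith [ht.2]⟩, mem_univ _⟩
    have hQK : parabolicCylinder r ((T : ℝ), x) ⊆ K := by
      rintro ⟨t, y⟩ hz
      simp only [parabolicCylinder, mem_prod, mem_Ioo, mem_ball] at hz
      exact ⟨⟨hz.1.1.le, hz.1.2.le⟩, mem_closedBall.2 hz.2.le⟩
    -- the smooth version `w` is bounded on `K`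
    have hwc : ContinuousOn (uncurry w) K := (hw.continuousOn).mono hKsub
    obtain ⟨M, hM⟩ := hKc.exists_bound_of_continuousOn hwc
    -- `v = w` a.e. on the cylinder
    have hQmeas : MeasurableSet (parabolicCylinder r ((T : ℝ), x)) :=
      (isOpen_parabolicCylinder r _).measurableSet
    have hae : ∀ᵐ z ∂(volume.restrict (parabolicCylinder r ((T : ℝ), x))), uncurry v z = uncurry w z := by
      have h1 : ∀ᵐ z ∂(volume.restrict (slab (T + 1) : Set (ℝ × E3))), uncurry v z = uncurry w z :=
        hwv.mono fun z hz => hz.symm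
      exact ae_restrict_of_ae_restrict_of_subset (hQK.trans hKsub) h1
    have hbdd : ∀ᵐ z ∂(volume.restrict (parabolicCylinder r ((T : ℝ), x))), ‖uncurry v z‖ ≤ M := by
      filter_upwards [hae, ae_restrict_mem hQmeas] with z hz hzQ
      rw [hz]; exact hM z (hQK hzQ)
    exact lt_of_le_of_lt (eLpNorm_le_of_ae_bound hbdd) (by simp)
  obtain ⟨U, P, hU, hP, hns, hE⟩ := clay_solution_of_locallyBounded_globalLerayHopf hν hu₀ hdiv hdec hv hbd
  exact ⟨U, P, hU, hP, hns, hE⟩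

/-- **Fefferman (A) (all viscosities) from the §5.3–§5.4 corollary at ONE viscosity `ν > 0`** (the tree's scaling
`clayR3_regularityAt_iff`): the corollary face of the claim IS Clay (A), binder-free.
[cite: FeffermanClay2006, (A) p. 2] [cite: Taghizadeh2026, §5.4 p.13 l.1–15] -/
theorem clayA_regularity_of_corollary {ν lam : ℝ} {χ : ℝ → ℝ} (hν : 0 < ν) (hlam : 0 < lam) (hχ : IsCutoff χ)
    (hcor : ClaimedCorollary ν lam χ) : ClayVariants.clayR3.Regularity :=
  (ClayVariants.clayR3_regularityAt_iff hν).1 (clayA_of_corollary hν hlam hχ hcor)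

/-- **Fefferman (A) (all viscosities) from the whole printed chain at ONE viscosity `ν > 0`** — through the corollary,
no bridge. [cite: FeffermanClay2006, (A) p. 2] [cite: Taghizadeh2026, Thm 1.1; §5.3–§5.4] -/
theorem clayA_regularity_of_all_steps {ν lam : ℝ} {χ : ℝ → ℝ} (hν : 0 < ν) (hlam : 0 < lam) (hχ : IsCutoff χ)
    (h29 : Step29_AlmostMono ν lam χ) (h37 : Step37_PersistentValue ν lam χ)
    (h41x : Step41_ExactInequality ν lam χ) (h42 : Step42_Vanishing ν lam χ)
    (h41 : StepL41_Rigidity ν χ) (h44 : Step44_Contradiction ν lam χ)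
    (h45 : Step45_NonnegLimit_implicit ν lam χ) (h53 : Step53_Reduction ν lam χ) (h54 : Step54_Smooth ν) :
    ClayVariants.clayR3.Regularity :=
  clayA_regularity_of_corollary hν hlam hχ (corollary_of_all_steps h29 h37 h41x h42 h41 h44 h45 h53 h54)

section Step42E

/-! ## REV 3 (additive; ns-claims-lit-3 g9, D-0026 idle pass after ADJUDICATED #153; custodian typist-10 g5, GO
salvage-p2 g6 16:21:15Z): §4.2 «Vanishing of the Dissipation Square Term» HOLDS on the honest carrier —
`step42E_Vanishing_holds : ∀ ν lam χ, Step42E_Vanishing ν lam χ`. The one thing the kernel needs beyond the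
print is the a.e.-measurability of the scale function `ρ ↦ D*(ρ; 0)` (`aemeasurable_DfunE`). Every rev-1/rev-2
declaration above is byte-identical. -/


/-! #### Cylinders about the origin -/

/-- Membership in the cylinder `Q_r(0) = (−r², 0) × B_r` about the origin. [folklore] -/
private theorem mem_parabolicCylinder_orig {r : ℝ} {z : ℝ × E3} :
    z ∈ parabolicCylinder r orig ↔ -r ^ 2 < z.1 ∧ z.1 < 0 ∧ ‖z.2‖ < r := by
  simp [parabolicCylinder, orig, mem_prod, mem_Ioo, mem_ball, dist_zero_right, and_assoc]

/-- Cylinders about the origin lie in the open past. [folklore] -/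
private theorem parabolicCylinder_orig_subset_past (r : ℝ) :
    parabolicCylinder r orig ⊆ (past : Set (ℝ × E3)) := by
  intro z hz
  rw [mem_parabolicCylinder_orig] at hz
  change z ∈ Iio (0 : ℝ) ×ˢ (univ : Set E3)
  exact ⟨hz.2.1, mem_univ _⟩

/-- Cylinders about the origin are measurable. [folklore] -/
private theorem measurableSet_parabolicCylinder_orig (r : ℝ) :
    MeasurableSet (parabolicCylinder r orig) :=
  measurableSet_Ioo.prod measurableSet_ball

/-- The parameter region `{ρ > 0} × {t < 0} × ℝ³` on which the localised kernel is smooth in `(ρ, t, x)`. [folklore] -/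
private def kerRegion : Set (ℝ × (ℝ × E3)) := {q | 0 < q.1 ∧ q.2.1 < 0}

/-- The smooth region is open. [folklore] -/
private theorem isOpen_kerRegion : IsOpen kerRegion :=
  (isOpen_lt continuous_const continuous_fst).inter
    (isOpen_lt (continuous_fst.comp continuous_snd) continuous_const)

/-- The joint set `{(ρ, z) : z ∈ Q_ρ(0)}`. [folklore] -/
private def cylRegion : Set (ℝ × (ℝ × E3)) := {q | q.2 ∈ parabolicCylinder q.1 orig}

/-- Membership in the joint cylinder region. [folklore] -/
private theorem mem_cylRegion {q : ℝ × (ℝ × E3)} :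
    q ∈ cylRegion ↔ -q.1 ^ 2 < q.2.1 ∧ q.2.1 < 0 ∧ ‖q.2.2‖ < q.1 := by
  simp only [cylRegion, mem_setOf_eq, mem_parabolicCylinder_orig]

/-- The joint cylinder region is measurable. [folklore] -/
private theorem measurableSet_cylRegion : MeasurableSet cylRegion := by
  have h1 : MeasurableSet {q : ℝ × (ℝ × E3) | -q.1 ^ 2 < q.2.1} :=
    measurableSet_lt (by fun_prop) (by fun_prop)
  have h2 : MeasurableSet {q : ℝ × (ℝ × E3) | q.2.1 < 0} :=
    measurableSet_lt (by fun_prop) measurable_const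
  have h3 : MeasurableSet {q : ℝ × (ℝ × E3) | ‖q.2.2‖ < q.1} :=
    measurableSet_lt (by fun_prop) (by fun_prop)
  have : cylRegion = ({q : ℝ × (ℝ × E3) | -q.1 ^ 2 < q.2.1} ∩ {q | q.2.1 < 0}) ∩ {q | ‖q.2.2‖ < q.1} := by
    ext q; simp only [mem_cylRegion, mem_inter_iff, mem_setOf_eq, and_assoc]
  rw [this]
  exact (h1.inter h2).inter h3

/-- The joint cylinder region lies in the smooth region. [folklore] -/
private theorem cylRegion_subset_kerRegion : cylRegion ⊆ kerRegion := by
  intro q hq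
  rw [mem_cylRegion] at hq
  exact ⟨(norm_nonneg _).trans_lt hq.2.2, hq.2.1⟩

/-! #### Joint smoothness of the localised kernel on `kerRegion` -/

variable {ν : ℝ} {χ : ℝ → ℝ}

/-- The localised kernel as a function of `(ρ, t, x)`. [folklore] -/
private def PhiJ (ν : ℝ) (χ : ℝ → ℝ) (q : ℝ × (ℝ × E3)) : ℝ := Phi ν χ q.1 orig q.2.1 q.2.2

/-- The localised kernel is `C¹` jointly in `(ρ, t, x)` on the smooth region (`t < 0` branch of `heatKer`, `sdist` polynomial in `‖x‖²`, `χ` smooth; `ν > 0`). [folklore] -/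
private theorem contDiffOn_PhiJ (hν : 0 < ν) (hχ : IsCutoff χ) : ContDiffOn ℝ 1 (PhiJ ν χ) kerRegion := by
  -- the explicit formula valid on the region (`t < 0` branch of `heatKer`)
  have hform : ∀ q ∈ kerRegion, PhiJ ν χ q =
      ((4 * Real.pi * ν * (0 - q.2.1)) ^ (-(3 : ℝ) / 2) *
        Real.exp (-(‖q.2.2 - (0 : E3)‖ ^ 2) / (4 * ν * (0 - q.2.1)))) *
      χ (‖q.2.2 - (0 : E3)‖ ^ 2 / q.1 ^ 2 + (0 - q.2.1) / q.1 ^ 2) := by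
    intro q hq
    simp only [PhiJ, Phi, heatKer, sdist, orig, if_pos hq.2]
  refine ContDiffOn.congr ?_ hform
  have hb : ∀ q ∈ kerRegion, (4 * Real.pi * ν * (0 - q.2.1) : ℝ) ≠ 0 := by
    intro q hq
    have : 0 < 4 * Real.pi * ν * (0 - q.2.1) := by
      have := Real.pi_pos; have := hq.2; positivity
    exact this.ne'
  have hd : ∀ q ∈ kerRegion, (4 * ν * (0 - q.2.1) : ℝ) ≠ 0 := by
    intro q hq
    have : 0 < 4 * ν * (0 - q.2.1) := by have := hq.2; nlinarith
    exact this.ne'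
  have hr : ∀ q ∈ kerRegion, (q.1 ^ 2 : ℝ) ≠ 0 := fun q hq => pow_ne_zero 2 hq.1.ne'
  have hlin : ContDiffOn ℝ 1 (fun q : ℝ × (ℝ × E3) => 4 * Real.pi * ν * (0 - q.2.1)) kerRegion := by
    fun_prop
  have hnsq : ContDiffOn ℝ 1 (fun q : ℝ × (ℝ × E3) => ‖q.2.2 - (0 : E3)‖ ^ 2) kerRegion :=
    ((contDiff_snd.comp contDiff_snd).sub contDiff_const).contDiffOn.norm_sq ℝ
  have h1 : ContDiffOn ℝ 1 (fun q : ℝ × (ℝ × E3) => (4 * Real.pi * ν * (0 - q.2.1)) ^ (-(3 : ℝ) / 2))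
      kerRegion := hlin.rpow_const_of_ne hb
  have h2 : ContDiffOn ℝ 1 (fun q : ℝ × (ℝ × E3) =>
      Real.exp (-(‖q.2.2 - (0 : E3)‖ ^ 2) / (4 * ν * (0 - q.2.1)))) kerRegion := by
    refine Real.contDiff_exp.comp_contDiffOn (ContDiffOn.div hnsq.neg (by fun_prop) hd)
  have h3 : ContDiffOn ℝ 1 (fun q : ℝ × (ℝ × E3) =>
      χ (‖q.2.2 - (0 : E3)‖ ^ 2 / q.1 ^ 2 + (0 - q.2.1) / q.1 ^ 2)) kerRegion := by
    refine (hχ.smooth.of_le (by norm_cast)).comp_contDiffOn ?_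
    exact (ContDiffOn.div hnsq (by fun_prop) hr).add (ContDiffOn.div (by fun_prop) (by fun_prop) hr)
  exact (h1.mul h2).mul h3

/-- The localised kernel is continuous jointly on the smooth region. [folklore] -/
private theorem continuousOn_PhiJ (hν : 0 < ν) (hχ : IsCutoff χ) : ContinuousOn (PhiJ ν χ) kerRegion :=
  (contDiffOn_PhiJ hν hχ).continuousOn

/-! #### The spatial gradient of the kernel is continuous in `(ρ, t, x)` on `kerRegion` -/

/-- The inclusion `y ↦ (ρ, (t, y))` of a spatial slice. [folklore] -/
private def sliceIncl (ρ t : ℝ) (y : E3) : ℝ × (ℝ × E3) := (ρ, (t, y))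

/-- Its (constant) derivative. [folklore] -/
private def sliceInclDeriv : E3 →L[ℝ] ℝ × (ℝ × E3) :=
  (0 : E3 →L[ℝ] ℝ).prod ((0 : E3 →L[ℝ] ℝ).prod (ContinuousLinearMap.id ℝ E3))

/-- Derivative of the slice inclusion. [folklore] -/
private theorem hasFDerivAt_sliceIncl (ρ t : ℝ) (y : E3) :
    HasFDerivAt (sliceIncl ρ t) sliceInclDeriv y :=
  (hasFDerivAt_const ρ y).prodMk ((hasFDerivAt_const t y).prodMk (hasFDerivAt_id y))

/-- On `kerRegion` the spatial slice `y ↦ Φ_{ρ,0}(y, t)` is differentiable with derivative the joint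
derivative composed with the slice inclusion. [folklore] -/
private theorem hasFDerivAt_Phi_slice (hν : 0 < ν) (hχ : IsCutoff χ) {q : ℝ × (ℝ × E3)} (hq : q ∈ kerRegion) :
    HasFDerivAt (fun y => Phi ν χ q.1 orig q.2.1 y) ((fderiv ℝ (PhiJ ν χ) q).comp sliceInclDeriv) q.2.2 := by
  have hdiff : DifferentiableAt ℝ (PhiJ ν χ) q :=
    ((contDiffOn_PhiJ hν hχ).differentiableOn one_ne_zero).differentiableAt (isOpen_kerRegion.mem_nhds hq)
  have hcomp := hdiff.hasFDerivAt.comp q.2.2 (hasFDerivAt_sliceIncl q.1 q.2.1 q.2.2)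
  exact hcomp

/-- The spatial gradient of the kernel = joint derivative ∘ slice inclusion, dualised. [folklore] -/
private theorem gradient_Phi_slice_eq (hν : 0 < ν) (hχ : IsCutoff χ) {q : ℝ × (ℝ × E3)} (hq : q ∈ kerRegion) :
    gradient (fun y => Phi ν χ q.1 orig q.2.1 y) q.2.2 =
      (InnerProductSpace.toDual ℝ E3).symm ((fderiv ℝ (PhiJ ν χ) q).comp sliceInclDeriv) := by
  unfold gradient
  rw [(hasFDerivAt_Phi_slice hν hχ hq).fderiv]

/-- The spatial gradient of the kernel is continuous jointly in `(ρ, t, x)` on the smooth region. [folklore] -/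
private theorem continuousOn_gradient_Phi_slice (hν : 0 < ν) (hχ : IsCutoff χ) :
    ContinuousOn (fun q : ℝ × (ℝ × E3) => gradient (fun y => Phi ν χ q.1 orig q.2.1 y) q.2.2) kerRegion := by
  have hc : ContinuousOn (fderiv ℝ (PhiJ ν χ)) kerRegion :=
    (contDiffOn_PhiJ hν hχ).continuousOn_fderiv_of_isOpen isOpen_kerRegion le_rfl
  have hc' : ContinuousOn (fun q => (InnerProductSpace.toDual ℝ E3).symm
      ((fderiv ℝ (PhiJ ν χ) q).comp sliceInclDeriv)) kerRegion :=
    (InnerProductSpace.toDual ℝ E3).symm.continuous.comp_continuousOn (hc.clm_comp continuousOn_const)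
  exact hc'.congr fun q hq => gradient_Phi_slice_eq hν hχ hq

/-! #### Continuity of the algebraic gadgets -/

/-- `(a, w) ↦ a ⊗ w` is continuous. [folklore] -/
private theorem continuous_tensor : Continuous fun p : E3 × E3 => tensor p.1 p.2 := by
  have h := (isBoundedBilinearMap_smulRight (𝕜 := ℝ) (E := E3) (F := E3)).continuous
  have h2 : Continuous fun p : E3 × E3 => ((innerSL ℝ p.2 : E3 →L[ℝ] ℝ), p.1) :=
    ((innerSL ℝ).continuous.comp continuous_snd).prodMk continuous_fst
  exact h.comp h2

/-- The Frobenius square norm is continuous on `E3 →L[ℝ] E3`. [folklore] -/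
private theorem continuous_frobeniusNormSq' : Continuous fun L : E3 →L[ℝ] E3 => frobeniusNormSq L := by
  unfold frobeniusNormSq
  refine continuous_finsetSum _ fun i _ => ?_
  exact ((ContinuousLinearMap.apply ℝ E3 (stdOrthonormalBasis ℝ E3 i)).continuous).norm.pow 2

/-! #### AE-measurability of `ρ ↦ D(ρ; 0)` on intervals away from `0` -/

variable {us : ℝ → E3 → E3} {ps : ℝ → E3 → ℝ} {Gs : ℝ → E3 → E3 →L[ℝ] E3}

/-- The core joint integrand `(ρ, z) ↦ |G̃(z) − ũ(z) ⊗ ∇log Φ_ρ(z)|² Φ_ρ(z)` (as `ℝ≥0∞`), for measurable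
representatives `ũ`, `G̃`. [folklore] -/
private def coreIntegrand (ν : ℝ) (χ : ℝ → ℝ) (ũ : ℝ × E3 → E3) (Gt : ℝ × E3 → E3 →L[ℝ] E3)
    (q : ℝ × (ℝ × E3)) : ℝ≥0∞ :=
  ENNReal.ofReal (frobeniusNormSq (Gt q.2 - tensor (ũ q.2) (gradLogPhi ν χ q.1 orig q.2.1 q.2.2)) *
    Phi ν χ q.1 orig q.2.1 q.2.2)

/-- The core integrand is a.e.-measurable on the smooth region, for any measure there. [folklore] -/
private theorem aemeasurable_coreIntegrand (hν : 0 < ν) (hχ : IsCutoff χ)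
    {ũ : ℝ × E3 → E3} {Gt : ℝ × E3 → E3 →L[ℝ] E3} (hũ : Measurable ũ) (hGt : Measurable Gt)
    (μ2 : Measure (ℝ × (ℝ × E3))) :
    AEMeasurable (coreIntegrand ν χ ũ Gt) (μ2.restrict kerRegion) := by
  have hPhi : AEMeasurable (fun q : ℝ × (ℝ × E3) => Phi ν χ q.1 orig q.2.1 q.2.2)
      (μ2.restrict kerRegion) :=
    (continuousOn_PhiJ hν hχ).aemeasurable isOpen_kerRegion.measurableSet
  have hgrad : AEMeasurable (fun q : ℝ × (ℝ × E3) => gradient (fun y => Phi ν χ q.1 orig q.2.1 y) q.2.2)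
      (μ2.restrict kerRegion) :=
    (continuousOn_gradient_Phi_slice hν hχ).aemeasurable isOpen_kerRegion.measurableSet
  have hglp : AEMeasurable (fun q : ℝ × (ℝ × E3) => gradLogPhi ν χ q.1 orig q.2.1 q.2.2)
      (μ2.restrict kerRegion) := hPhi.inv.smul hgrad
  have hũ2 : AEMeasurable (fun q : ℝ × (ℝ × E3) => ũ q.2) (μ2.restrict kerRegion) :=
    (hũ.comp measurable_snd).aemeasurable
  have hG2 : AEMeasurable (fun q : ℝ × (ℝ × E3) => Gt q.2) (μ2.restrict kerRegion) :=
    (hGt.comp measurable_snd).aemeasurable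
  -- (the remaining compositions are left un-annotated: annotating them makes the unifier unfold `tensor`)
  have htens := continuous_tensor.aemeasurable2 hũ2 hglp
  have hdiff := hG2.sub htens
  have hfrob := continuous_frobeniusNormSq'.measurable.comp_aemeasurable hdiff
  have hprod := hfrob.mul hPhi
  have hfin := ENNReal.measurable_ofReal.comp_aemeasurable hprod
  change AEMeasurable (fun q => coreIntegrand ν χ ũ Gt q) (μ2.restrict kerRegion)
  simp only [coreIntegrand]
  simpa only [Function.comp_def, Pi.sub_apply, Pi.mul_apply] using hfin

/-- With measurable representatives `ũ`, `G̃` of the ancient fields, the joint integrand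
`(ρ, z) ↦ 𝟙_{Q_ρ(0)}(z) · |G̃ − ũ ⊗ ∇log Φ_ρ|² Φ_ρ` is a.e.-measurable for a product measure. [folklore] -/
private theorem aemeasurable_jointIntegrand (hν : 0 < ν) (hχ : IsCutoff χ)
    {ũ : ℝ × E3 → E3} {Gt : ℝ × E3 → E3 →L[ℝ] E3} (hũ : Measurable ũ) (hGt : Measurable Gt)
    (μ2 : Measure (ℝ × (ℝ × E3))) :
    AEMeasurable (cylRegion.indicator (coreIntegrand ν χ ũ Gt)) μ2 := by
  refine (aemeasurable_indicator_iff measurableSet_cylRegion).2 ?_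
  exact (aemeasurable_coreIntegrand hν hχ hũ hGt μ2).mono_measure
    (Measure.restrict_mono cylRegion_subset_kerRegion le_rfl)

/-- The indicator of the joint region, evaluated at `(ρ, z)`, is the indicator of the cylinder `Q_ρ(0)`. [folklore] -/
private theorem cylRegion_indicator_apply (F : ℝ × (ℝ × E3) → ℝ≥0∞) (ρ : ℝ) (z : ℝ × E3) :
    cylRegion.indicator F (ρ, z) = (parabolicCylinder ρ orig).indicator (fun w => F (ρ, w)) z := by
  by_cases hz : z ∈ parabolicCylinder ρ orig
  · rw [indicator_of_mem hz, indicator_of_mem (show (ρ, z) ∈ cylRegion from hz)]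
  · rw [indicator_of_notMem hz, indicator_of_notMem (show (ρ, z) ∉ cylRegion from hz)]

/-- **AE-measurability of the square term in the scale variable.** For an ancient field pair with a weak
gradient, `ρ ↦ D(ρ; 0) = DfunE ν χ ρ orig us Gs` is a.e.-measurable on every interval `(R₁, R₂)` (the kernel-side content the print's §4.2 passage «Hence …
D*(ρ; 0) = 0 for a.e. ρ > 0» needs). [cite: Taghizadeh2026, §2.9 p.6 l.38–44; §4.1 p.10 l.19–26; §4.2 p.10 l.27–53] -/
theorem aemeasurable_DfunE (hν : 0 < ν) (hχ : IsCutoff χ) (hg : HasWeakSpatialGradientOn past us Gs)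
    (R₁ R₂ : ℝ) :
    AEMeasurable (fun ρ => DfunE ν χ ρ orig us Gs) (volume.restrict (Ioo R₁ R₂)) := by
  -- measurable representatives of the fields on the past
  have hum : AEStronglyMeasurable (uncurry us) (volume.restrict (past : Set (ℝ × E3))) :=
    hg.locallyIntegrableOn.aestronglyMeasurable
  have hGm : AEStronglyMeasurable (uncurry Gs) (volume.restrict (past : Set (ℝ × E3))) :=
    hg.locallyIntegrableOn_grad.aestronglyMeasurable
  set ũ := hum.mk (uncurry us) with hũdef
  set Gt := hGm.mk (uncurry Gs) with hGtdef
  have hũ : Measurable ũ := hum.stronglyMeasurable_mk.measurable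
  have hGt : Measurable Gt := hGm.stronglyMeasurable_mk.measurable
  have hequ : uncurry us =ᵐ[volume.restrict (past : Set (ℝ × E3))] ũ := hum.ae_eq_mk
  have heqG : uncurry Gs =ᵐ[volume.restrict (past : Set (ℝ × E3))] Gt := hGm.ae_eq_mk
  -- the joint integrand and its ρ-sections
  have hH : AEMeasurable (cylRegion.indicator (coreIntegrand ν χ ũ Gt))
      ((volume.restrict (Ioo R₁ R₂)).prod (volume : Measure (ℝ × E3))) :=
    aemeasurable_jointIntegrand hν hχ hũ hGt _
  have hsec : AEMeasurable (fun ρ => ∫⁻ z, cylRegion.indicator (coreIntegrand ν χ ũ Gt) (ρ, z) ∂volume)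
      (volume.restrict (Ioo R₁ R₂)) := hH.lintegral_prod_right'
  -- identify the sections with `DfunE`
  refine hsec.congr (Filter.Eventually.of_forall fun ρ => ?_)
  simp only [cylRegion_indicator_apply]
  rw [lintegral_indicator (measurableSet_parabolicCylinder_orig ρ)]
  unfold DfunE
  refine setLIntegral_congr_fun_ae (measurableSet_parabolicCylinder_orig ρ) ?_
  have h1 : ∀ᵐ z ∂volume.restrict (parabolicCylinder ρ orig), uncurry us z = ũ z :=
    ae_restrict_of_ae_restrict_of_subset (parabolicCylinder_orig_subset_past ρ) hequ
  have h2 : ∀ᵐ z ∂volume.restrict (parabolicCylinder ρ orig), uncurry Gs z = Gt z :=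
    ae_restrict_of_ae_restrict_of_subset (parabolicCylinder_orig_subset_past ρ) heqG
  have h12 := h1.and h2
  rw [ae_restrict_iff' (measurableSet_parabolicCylinder_orig ρ)] at h12
  filter_upwards [h12] with z hz hzmem
  obtain ⟨hu', hG'⟩ := hz hzmem
  simp only [coreIntegrand, uncurry] at hu' hG' ⊢
  rw [← hu', ← hG']

/-! #### The discharge -/

/-- On an interval `(R₁, R₂)` with `0 < R₁`, a vanishing weighted scale integral forces `D(ρ; 0) = 0` a.e. [folklore] -/
private theorem ae_DfunE_eq_zero_of_sqTermE_eq_zero (hν : 0 < ν) (hχ : IsCutoff χ)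
    (hg : HasWeakSpatialGradientOn past us Gs) {R₁ R₂ : ℝ} (hR₁ : 0 < R₁)
    (h0 : sqTermE ν χ R₁ R₂ orig us Gs = 0) :
    ∀ᵐ ρ ∂volume.restrict (Ioo R₁ R₂), DfunE ν χ ρ orig us Gs = 0 := by
  have hAE : AEMeasurable (fun ρ => ENNReal.ofReal ρ⁻¹ * DfunE ν χ ρ orig us Gs)
      (volume.restrict (Ioo R₁ R₂)) :=
    (ENNReal.measurable_ofReal.comp measurable_inv).aemeasurable.mul (aemeasurable_DfunE hν hχ hg R₁ R₂)
  have hz := (lintegral_eq_zero_iff' hAE).1 h0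
  filter_upwards [hz, ae_restrict_mem measurableSet_Ioo] with ρ hρ hmem
  have hρ0 : 0 < ρ := hR₁.trans hmem.1
  have hne : ENNReal.ofReal ρ⁻¹ ≠ 0 := by
    rw [Ne, ENNReal.ofReal_eq_zero, not_le]; exact inv_pos.2 hρ0
  simpa [hne] using hρ

/-- **§4.2 p.10 l.27–53 «Vanishing of the Dissipation Square Term» HOLDS on the honest carrier** (rev 2 face
`Step42E_Vanishing`): along a rigid limit, `I*(R; 0) ≡ ε₀` makes the right side of the exact inequality
`ofReal c · ∫_{R₁}^{R₂} ρ⁻¹ D* ≤ ofReal (I*(R₂) − I*(R₁))` vanish, so `∫⁻_{(R₁,R₂)} ρ⁻¹ D* = 0` for all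
`0 < R₁ < R₂` (`c > 0`), hence `D*(ρ; 0) = 0` for a.e. `ρ > 0` — the kernel needs, beyond the print, the
a.e.-measurability of `ρ ↦ D*(ρ; 0)` (`aemeasurable_DfunE`: measurable representatives of `u*`, `∇u*` on the
past, joint smoothness of `Φ_{ρ,0}` in `(ρ, t, x)` on `{ρ > 0} × {t < 0} × ℝ³`, Tonelli) and a countable cover
of `(0, ∞)`. [cite: Taghizadeh2026, §4.2 p.10 l.27–53] -/
theorem step42E_Vanishing_holds (ν lam : ℝ) (χ : ℝ → ℝ) : Step42E_Vanishing ν lam χ := by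
  intro hν _hlam hχ us ps Gs ε0 hrig
  obtain ⟨hanc, hconst, c, hc, hineq⟩ := hrig
  have hg : HasWeakSpatialGradientOn past us Gs := hanc.grad
  -- every weighted scale integral vanishes
  have hsq : ∀ R₁ R₂ : ℝ, 0 < R₁ → R₁ < R₂ → sqTermE ν χ R₁ R₂ orig us Gs = 0 := by
    intro R₁ R₂ hR₁ hlt
    have h := hineq R₁ R₂ hR₁ hlt
    rw [hconst R₂ (hR₁.trans hlt), hconst R₁ hR₁, sub_self, ENNReal.ofReal_zero, nonpos_iff_eq_zero,
      mul_eq_zero] at h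
    rcases h with h | h
    · exact absurd h (by rw [ENNReal.ofReal_eq_zero, not_le]; exact hc)
    · exact h
  -- countable cover of `(0, ∞)` by intervals away from `0`
  have hcover : Ioi (0 : ℝ) = ⋃ n : ℕ, Ioo ((n : ℝ) + 2)⁻¹ ((n : ℝ) + 2) := by
    ext ρ
    simp only [mem_Ioi, mem_iUnion, mem_Ioo]
    constructor
    · intro hρ
      obtain ⟨n, hn⟩ := exists_nat_gt (max ρ ρ⁻¹)
      refine ⟨n, ?_, ?_⟩
      · have h1 : ρ⁻¹ < (n : ℝ) + 2 := by
          have := le_max_right ρ ρ⁻¹; linarith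
        have h2 : 0 < (n : ℝ) + 2 := by positivity
        calc ((n : ℝ) + 2)⁻¹ < (ρ⁻¹)⁻¹ := by
              exact inv_strictAnti₀ (inv_pos.2 hρ) h1
          _ = ρ := inv_inv ρ
      · have := le_max_left ρ ρ⁻¹; linarith
    · rintro ⟨n, hn1, _⟩
      exact (inv_pos.2 (by positivity)).trans hn1
  rw [hcover, ae_restrict_iUnion_iff]
  intro n
  have hR : (0 : ℝ) < ((n : ℝ) + 2)⁻¹ := inv_pos.2 (by positivity)
  have hlt : ((n : ℝ) + 2)⁻¹ < (n : ℝ) + 2 := by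
    have h2 : (1 : ℝ) < (n : ℝ) + 2 := by
      have : (0 : ℝ) ≤ n := n.cast_nonneg; linarith
    exact (inv_lt_one_of_one_lt₀ h2).trans h2
  exact ae_DfunE_eq_zero_of_sqTermE_eq_zero hν hχ hg hR (hsq _ _ hR hlt)

end Step42E

end Literature.Claims.NS.Taghizadeh2026

end

-- WHAT THIS IS NOT: not a claim about NS regularity or blow-up; not a claim about any author beyond the typed locator.
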